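import Literature.Probability.RandomPlanarGeometry.HexSAWSurfaceWallRenewalThirteenthExact
import HarnessLib

/-!
# The fourteenth-order census identity of the adsorbed honeycomb walk:
# `y¹³ (β(y)² − y − 1/y − 1/y² − 2/y³ − 4/y⁴ − 6/y⁵ − 12/y⁶ − 18/y⁷ − 15/y⁸ − 7/y⁹ + 16/y¹⁰ + 109/y¹¹ + 332/y¹²) → N₁₅,₁ + N₁₆,₂ + N₁₇,₃ + N₁₈,₄ + N₁₉,₅ + N₂₀,₆ + N₂₁,₇ − 215023`

`β(y) = wallRate y` is the exponential growth rate of wall bridges of self-avoiding walks on the brick-wall (hexagonal) lattice along a zigzag wall with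
contact fugacity `y`; `N_{s,v} = #{ω ∈ ipwb (2s) : visits = v}`.  With «CENSUS-THIRTEEN-A … E» the diagonal `s − v = 13` is complete (`17356 / 23296 / 17048 / 7839 /
1627 / 57`) and «A12-EXACT» gives `β² = y + 1/y + … − 109/y¹¹ − 332/y¹² + o(y⁻¹²)`.  This module is the template once more: the FOURTEENTH coefficient EXISTS and equals
the diagonal-`14` census minus `215023`, the seven classes `(15,1), …, (21,7)` symbolic (`hᵢ : mᵢ = 30, …, 42`; `N₂₁,₇ = 1` is the six-step rigidity of CAR 73 and
`N₂₀,₆` a slack-four class, both kept symbolic here):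

  ★★★ `tendsto_pow_thirteen_mul_wallRate_sq_sub_census : y¹³ (β² − y − … + 109/y¹¹ + 332/y¹²) → N₁₅,₁ + N₁₆,₂ + N₁₇,₃ + N₁₈,₄ + N₁₉,₅ + N₂₀,₆ + N₂₁,₇ − 215023`.

Data (the fast engine's replica, a-p6 g23; REPLICATED with the tower constant by a-ref-2 g60 (kit j291615) and a-ref-1 g69, 2026-08-27):
`51018 / 70726 / 55092 / 28622 / 8045 / 649 / 1` (sum `214153`) ⇒ `a₁₃ = −870`.
METHOD: (§1) the twelfth tower rung `R₁₂ = y¹²(1 − r) − y¹⁰ − y⁹ − y⁸ − 2y⁷ − 2y⁶ − 3y⁵ − 2y⁴ + 16y³ + 46y² + 73y → −139` (from `a₁₁ = −109`, «A11-EXACT», by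
`R₁₂ = D₁₁·r − R₁₀ − R₉ − 2M − 4L − 6K − 12H − 18P − 15Q − 7A + 16A/y`) and the class bounds at `n = 30, …, 44`; (§2) the order-fourteen head sandwich (tail at
`n = 22`, `θ₃^{22} ≍ y^{−44/3}`); (§3) tail → 0; (§4) exact identity `T − G = y¹³β²(1 − H₁₄)`; (§5) `G → ΣN − 215023` by a 120-monomial identity in the tower
`A, Q, P, H, K, L, M, R₉, R₁₀, R₁₁, R₁₂` and `u`; (§6) squeeze.
HONEST LABEL.  LANE THEOREM, DERIVED; NEW IN WRITING (modest): the constant `215023` (exact rationals: `HOME/pub-sawmu-a-p6/g23/fourteen/ed1/cells/` — `tower14.py`,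
`comb14.txt`).  Print: `β ∼ √y` ([BeatonBousquetMelouDeGierDuminilCopinGuttmann2014, §3.1, Proposition 5, p. 10]), renewal theory ([MadrasSlade1993, §4.2], [Kesten1963SAW, §4]).
NOT CLAIMED: the class numbers, hence not `a₁₃ = −870`.  No definitions.
Budget lines: `set_option maxHeartbeats 1600000 in` before `fourteenth_order_two_sided_of_cube_lt` (the `field_simp; ring` identity), `800000` before
`kesten_head_fourteen_sandwich_of_cube_lt` and `tendsto_fourteenth_order_comparison`, and `set_option maxRecDepth 4096 in` on the ten declarations whose statements carry the
80-term closed forms (elaboration depth of the left-nested sums at this order; the order-thirteen module was just below the default); nothing else.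
-/

noncomputable section

namespace Literature.Probability.RandomPlanarGeometry.SAW.HexBW.Wall

open Finset Filter Function
open Literature.Probability.LatticeModels
open _root_.Topology Asymptotics

variable {y : ℝ} {n : ℕ} {ω : ℕ → Site 2}

/-! ### §0  Private helpers -/

/-- [folklore] Relabel the limit of a `Tendsto` by an equal constant. -/
private theorem tendsto_of_tendsto_of_eq_fo {f : ℝ → ℝ} {L c : ℝ} (h : Tendsto f atTop (𝓝 L)) (e : L = c) :
    Tendsto f atTop (𝓝 c) := e ▸ h

/-- [folklore] `f₁(y) ≤ y/β(y)²` (the class `(1,1)` is the straight walk, so `Λ₂ ≤ y`; private copy of the census-identity modules' lemma).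
[cite: MadrasSlade1993, §4.2, Theorem 4.2.2(b) (pp. 91–92)] -/
private theorem pwbLaw_one_le_div_fo (hy : 0 ≤ y) : pwbLaw y 1 ≤ y / wallRate y ^ 2 := by
  classical
  have hsub : pwb 2 ⊆ {Zd.straightWalk 2 2} := by
    intro ω hω
    rw [Finset.mem_singleton]
    obtain ⟨hwbr, hbr⟩ := mem_pwb.1 hω
    obtain ⟨harch, -⟩ := mem_wbr.1 hwbr
    obtain ⟨hhpw, -, h21⟩ := mem_archs.1 harch
    obtain ⟨hsaw, -⟩ := mem_hpw.1 hhpw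
    obtain ⟨h0, hend, hbw, -⟩ := mem_saws_iff.1 hsaw
    have h00 : ω 0 0 = 0 := by simp [h0]
    have h01 : ω 0 1 = 0 := by simp [h0]
    have hs0 : brickWallGraph.Adj (ω 0) (ω 1) := hbw 0 (by norm_num)
    have hs1 : brickWallGraph.Adj (ω 1) (ω 2) := hbw 1 (by norm_num)
    rw [brickWallGraph_adj_coord] at hs0 hs1
    have hb1 : ω 0 0 < ω 1 0 ∧ ω 1 0 ≤ ω 2 0 := hbr 1 le_rfl (by norm_num)
    have h10 : ω 1 0 = 1 := by omega
    have h11 : ω 1 1 = 0 := by omega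
    have h20 : ω 2 0 = 2 := by omega
    funext i
    have hX : ω i 0 = ((min i 2 : ℕ) : ℤ) := by
      rcases Nat.lt_or_ge i 2 with hi | hi
      · interval_cases i
        · simp [h00]
        · simp [h10]
      · rw [hend i hi, min_eq_right hi, h20]; norm_num
    have hY : ω i 1 = 0 := by
      rcases Nat.lt_or_ge i 2 with hi | hi
      · interval_cases i
        · exact h01
        · exact h11
      · rw [hend i hi, h21]
    funext j
    fin_cases j
    · simpa [straightWalk_apply_zero] using hX
    · simpa [straightWalk_apply_one] using hY
  have hv : visits 2 (Zd.straightWalk 2 2) = 1 := (straightWalk_mem_pwb 1).2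
  have hP : PWB 2 y ≤ y := by
    unfold PWB
    calc ∑ ω ∈ pwb 2, y ^ visits 2 ω ≤ ∑ ω ∈ ({Zd.straightWalk 2 2} : Finset (ℕ → Site 2)), y ^ visits 2 ω :=
          Finset.sum_le_sum_of_subset_of_nonneg hsub (fun _ _ _ => pow_nonneg hy _)
      _ = y := by rw [Finset.sum_singleton, hv, pow_one]
  show IPWB 2 y / wallRate y ^ 2 ≤ y / wallRate y ^ 2
  exact div_le_div_of_nonneg_right ((IPWB_le_PWB 2 hy).trans hP) (pow_pos (wallRate_pos y) 2).le

/-- [folklore] A class count is at most `3^n`: `#((ipwb n).filter p) ≤ 3^n`. [cite: MadrasSlade1993, §1.2, (1.2.16) (p. 11)] -/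
private theorem card_filter_ipwb_le_fo (n : ℕ) (p : (ℕ → Site 2) → Prop) [DecidablePred p] :
    (#((ipwb n).filter p) : ℝ) ≤ 3 ^ n :=
  le_trans (by exact_mod_cast Finset.card_filter_le _ _) (card_ipwb_le_three_pow n)

/-- [folklore] `f_k(y) = Λ_{2k}(y)/β(y)^{2k}` with the length as a numeral. [cite: MadrasSlade1993, §4.2, (4.2.2)] -/
private theorem pwbLaw_eq_fo (k : ℕ) {m : ℕ} (hm : m = 2 * k) : pwbLaw y k = IPWB m y / wallRate y ^ m := by
  rw [pwbLaw, hm]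

/-- `y/β² → 1`. [cite: BeatonBousquetMelouDeGierDuminilCopinGuttmann2014, Section 3.1, Proposition 5 (arXiv v5 p. 9)] -/
private theorem tendsto_div_sq_wallRate_fo : Tendsto (fun y : ℝ => y / wallRate y ^ 2) atTop (𝓝 1) := by
  have h1 : Tendsto (fun y : ℝ => ((wallRate y / Real.sqrt y) ^ 2)⁻¹) atTop (𝓝 ((1 : ℝ) ^ 2)⁻¹) :=
    (tendsto_wallRate_div_sqrt.pow 2).inv₀ (by norm_num)
  rw [one_pow, inv_one] at h1
  refine h1.congr' ?_
  filter_upwards [eventually_gt_atTop (0 : ℝ)] with y hy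
  rw [div_pow, Real.sq_sqrt hy.le, inv_div]

/-- `β²/y → 1`. [cite: BeatonBousquetMelouDeGierDuminilCopinGuttmann2014, Section 3.1, Proposition 5 (arXiv v5 p. 9)] -/
private theorem tendsto_sq_wallRate_div_fo : Tendsto (fun y : ℝ => wallRate y ^ 2 / y) atTop (𝓝 1) := by
  have h1 : Tendsto (fun y : ℝ => (wallRate y / Real.sqrt y) ^ 2) atTop (𝓝 ((1 : ℝ) ^ 2)) := tendsto_wallRate_div_sqrt.pow 2
  rw [one_pow] at h1
  refine h1.congr' ?_
  filter_upwards [eventually_gt_atTop (0 : ℝ)] with y hy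
  rw [div_pow, Real.sq_sqrt hy.le]

/-- [folklore] Exponent bookkeeping: `(y^{2/3})^{22} = y¹⁴ · y^{2/3}` for `y > 0`. -/
private theorem rpow_two_thirds_pow_twentytwo_fo (hy : 0 < y) : (y ^ ((2 : ℝ) / 3)) ^ 22 = y ^ 14 * y ^ ((2 : ℝ) / 3) := by
  rw [← Real.rpow_natCast (y ^ ((2 : ℝ) / 3)) 22, ← Real.rpow_mul hy.le, ← Real.rpow_natCast y 14, ← Real.rpow_add hy]
  norm_num

/-- [folklore] `visits ≤ 6` on `ipwb n` for `4 ≤ n ≤ 41` (the six-step law `6·visits ≤ n`). [cite: MadrasSlade1993, §4.2, remark before (4.2.21) (p. 94)] -/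
private theorem visits_le_six_fo (h4 : 4 ≤ n) (h41 : n ≤ 41) (hω : ω ∈ ipwb n) : visits n ω ≤ 6 := by
  have h := six_mul_visits_le hω h4
  omega

/-- [folklore] `visits ≤ 7` on `ipwb n` for `4 ≤ n ≤ 47` (the six-step law `6·visits ≤ n`). [cite: MadrasSlade1993, §4.2, remark before (4.2.21) (p. 94)] -/
private theorem visits_le_seven_fo (h4 : 4 ≤ n) (h47 : n ≤ 47) (hω : ω ∈ ipwb n) : visits n ω ≤ 7 := by
  have h := six_mul_visits_le hω h4
  omega

/-! ### §1  The twelfth rung of the `β²`-tower and the class bounds at `n = 30, …, 44` -/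

/-- ★ **`y¹² (1 − y/β(y)²) − y¹⁰ − y⁹ − y⁸ − 2y⁷ − 2y⁶ − 3y⁵ − 2y⁴ + 16y³ + 46y² + 73y → −139`** — the twelfth rung `R₁₂` of the `β²`-tower, from the twelfth-order
limit `y¹¹(β² − y − … + 16/y¹⁰) → −109` («A11-EXACT») by `R₁₂ = D₁₁·r − R₁₀ − R₉ − 2M − 4L − 6K − 12H − 18P − 15Q − 7A + 16A/y`.
[cite: BeatonBousquetMelouDeGierDuminilCopinGuttmann2014, Section 3.1, Proposition 5 (arXiv v5 p. 9) and p. 10] -/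
theorem tendsto_pow_twelve_mul_one_sub_div_sub :
    Tendsto (fun y : ℝ => y ^ 12 * (1 - y / wallRate y ^ 2) - y ^ 10 - y ^ 9 - y ^ 8 - 2 * y ^ 7 - 2 * y ^ 6 - 3 * y ^ 5 - 2 * y ^ 4 + 16 * y ^ 3 +
      46 * y ^ 2 + 73 * y) atTop (𝓝 (-139)) := by
  have hr := tendsto_div_wallRate_sq
  have hA := tendsto_sq_mul_one_sub_div_wallRate_sq
  have hQ := tendsto_cube_mul_one_sub_div_sub
  have hP := tendsto_pow_four_mul_one_sub_div_sub
  have hH := tendsto_pow_five_mul_one_sub_div_sub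
  have hK := tendsto_pow_six_mul_one_sub_div_sub
  have hL := tendsto_pow_seven_mul_one_sub_div_sub
  have hM := tendsto_pow_eight_mul_one_sub_div_sub
  have hR := tendsto_pow_nine_mul_one_sub_div_sub
  have hW := tendsto_pow_ten_mul_one_sub_div_sub
  have hD := tendsto_pow_eleven_mul_wallRate_sq_sub
  have hu : Tendsto (fun y : ℝ => y⁻¹) atTop (𝓝 0) := tendsto_inv_atTop_zero
  have h := ((((((((((hD.mul hr).sub hW).sub hR).sub (hM.const_mul 2)).sub (hL.const_mul 4)).sub (hK.const_mul 6)).sub (hH.const_mul 12)).sub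
    (hP.const_mul 18)).sub (hQ.const_mul 15)).sub (hA.const_mul 7)).add ((hA.mul hu).const_mul 16)
  refine Tendsto.congr' ?_ (tendsto_of_tendsto_of_eq_fo h (by norm_num))
  filter_upwards [eventually_gt_atTop (0 : ℝ)] with y hy
  have hw : wallRate y ≠ 0 := (wallRate_pos y).ne'
  have hy' : y ≠ 0 := hy.ne'
  field_simp
  ring

open Classical in
/-- ★ `Λ₃₀(y) = N₁₅,₁·y + 23296y² + 5219y³ + 486y⁴ + y⁵` (`N₁₅,₂ = 23296` «CENSUS-THIRTEEN-B2», `5219` «-TWELVE-B», `486` «-ELEVEN-C3», `1` «-TEN-B»; `N₁₅,₁` symbolic).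
[cite: MadrasSlade1993, Section 4.2, (4.2.2) (p. 91)] -/
theorem IPWB_thirty_eq_census_fourteen {m : ℕ} (hm : m = 30) (y : ℝ) :
    IPWB m y = #((ipwb m).filter fun ω => visits m ω = 1) * y + 23296 * y ^ 2 + 5219 * y ^ 3 + 486 * y ^ 4 + y ^ 5 := by
  have e := IPWB_eq_sum_range_card_mul_pow (m := m) (V := 5) (fun ω hω => visits_le_five_of_le_thirtyfive (by omega) (by omega) hω) y
  simp only [Finset.sum_range_succ, Finset.sum_range_zero, card_zeroVisit_ipwb_eq_zero, card_twoVisit_ipwb_thirty_eq hm,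
    card_threeVisit_ipwb_thirty_eq hm, card_fourVisit_ipwb_thirty_eq hm, card_fiveVisit_ipwb_thirty_eq_one hm] at e
  rw [e]; push_cast; ring

open Classical in
/-- ★ `Λ₃₂`: `N_{16,2} * y ^ 2 + 17048 * y ^ 3 + 2018 * y ^ 4 + 32 * y ^ 5 ≤ Λ_32(y) ≤ 3^32·y + (the same)` for `y ≥ 0` (`visits ≤ 5` on `ipwb 32`; `17048`, `2018`, `32`).
[cite: MadrasSlade1993, Section 4.2, (4.2.2); Section 1.2, (1.2.16) (p. 11)] -/
theorem IPWB_thirtytwo_two_sided_fourteen {m : ℕ} (hm : m = 32) (hy : 0 ≤ y) :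
    #((ipwb m).filter fun ω => visits m ω = 2) * y ^ 2 + 17048 * y ^ 3 + 2018 * y ^ 4 + 32 * y ^ 5 ≤ IPWB m y ∧
      IPWB m y ≤ 3 ^ 32 * y + #((ipwb m).filter fun ω => visits m ω = 2) * y ^ 2 + 17048 * y ^ 3 + 2018 * y ^ 4 + 32 * y ^ 5 := by
  have e := IPWB_eq_sum_range_card_mul_pow (m := m) (V := 5) (fun ω hω => visits_le_five_of_le_thirtyfive (by omega) (by omega) hω) y
  simp only [Finset.sum_range_succ, Finset.sum_range_zero, card_zeroVisit_ipwb_eq_zero, card_threeVisit_ipwb_thirtytwo_eq hm, card_fourVisit_ipwb_thirtytwo_eq hm, card_fiveVisit_ipwb_thirtytwo_eq hm] at e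
  have h3 : (3 : ℝ) ^ m = 3 ^ 32 := by rw [hm]
  have hN1 := mul_le_mul_of_nonneg_right (card_filter_ipwb_le_fo m (fun ω => visits m ω = 1)) hy
  have hN1' : (0 : ℝ) ≤ #((ipwb m).filter fun ω => visits m ω = 1) * y := mul_nonneg (Nat.cast_nonneg _) hy
  rw [h3] at hN1
  constructor
  · rw [e]; push_cast; linarith [hN1']
  · rw [e]; push_cast; linarith [hN1]

open Classical in
/-- ★ `Λ₃₄`: `N_{17,3} * y ^ 3 + 7839 * y ^ 4 + 260 * y ^ 5 ≤ Λ_34(y) ≤ 3^34·(y + y ^ 2) + (the same)` for `y ≥ 0` (`visits ≤ 5` on `ipwb 34`; `7839`, `260`).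
[cite: MadrasSlade1993, Section 4.2, (4.2.2); Section 1.2, (1.2.16) (p. 11)] -/
theorem IPWB_thirtyfour_two_sided_fourteen {m : ℕ} (hm : m = 34) (hy : 0 ≤ y) :
    #((ipwb m).filter fun ω => visits m ω = 3) * y ^ 3 + 7839 * y ^ 4 + 260 * y ^ 5 ≤ IPWB m y ∧
      IPWB m y ≤ 3 ^ 34 * (y + y ^ 2) + #((ipwb m).filter fun ω => visits m ω = 3) * y ^ 3 + 7839 * y ^ 4 + 260 * y ^ 5 := by
  have e := IPWB_eq_sum_range_card_mul_pow (m := m) (V := 5) (fun ω hω => visits_le_five_of_le_thirtyfive (by omega) (by omega) hω) y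
  simp only [Finset.sum_range_succ, Finset.sum_range_zero, card_zeroVisit_ipwb_eq_zero, card_fourVisit_ipwb_thirtyfour_eq hm, card_fiveVisit_ipwb_thirtyfour_eq hm] at e
  have h3 : (3 : ℝ) ^ m = 3 ^ 34 := by rw [hm]
  have hN1 := mul_le_mul_of_nonneg_right (card_filter_ipwb_le_fo m (fun ω => visits m ω = 1)) hy
  have hN2 := mul_le_mul_of_nonneg_right (card_filter_ipwb_le_fo m (fun ω => visits m ω = 2)) (pow_nonneg hy 2)
  have hN1' : (0 : ℝ) ≤ #((ipwb m).filter fun ω => visits m ω = 1) * y := mul_nonneg (Nat.cast_nonneg _) hy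
  have hN2' : (0 : ℝ) ≤ #((ipwb m).filter fun ω => visits m ω = 2) * y ^ 2 := mul_nonneg (Nat.cast_nonneg _) (pow_nonneg hy 2)
  rw [h3] at hN1 hN2
  constructor
  · rw [e]; push_cast; linarith [hN1', hN2']
  · rw [e]; push_cast; linarith [hN1, hN2]

open Classical in
/-- ★ `Λ₃₆`: `N_{18,4} * y ^ 4 + 1627 * y ^ 5 + y ^ 6 ≤ Λ_36(y) ≤ 3^36·(y + y ^ 2 + y ^ 3) + (the same)` for `y ≥ 0` (`visits ≤ 6` on `ipwb 36`; `1627`, `1`).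
[cite: MadrasSlade1993, Section 4.2, (4.2.2); Section 1.2, (1.2.16) (p. 11)] -/
theorem IPWB_thirtysix_two_sided_fourteen {m : ℕ} (hm : m = 36) (hy : 0 ≤ y) :
    #((ipwb m).filter fun ω => visits m ω = 4) * y ^ 4 + 1627 * y ^ 5 + y ^ 6 ≤ IPWB m y ∧
      IPWB m y ≤ 3 ^ 36 * (y + y ^ 2 + y ^ 3) + #((ipwb m).filter fun ω => visits m ω = 4) * y ^ 4 + 1627 * y ^ 5 + y ^ 6 := by
  have e := IPWB_eq_sum_range_card_mul_pow (m := m) (V := 6) (fun ω hω => visits_le_six_fo (by omega) (by omega) hω) y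
  simp only [Finset.sum_range_succ, Finset.sum_range_zero, card_zeroVisit_ipwb_eq_zero, card_fiveVisit_ipwb_thirtysix_eq hm, card_sixVisit_ipwb_thirtysix_eq hm] at e
  have h3 : (3 : ℝ) ^ m = 3 ^ 36 := by rw [hm]
  have hN1 := mul_le_mul_of_nonneg_right (card_filter_ipwb_le_fo m (fun ω => visits m ω = 1)) hy
  have hN2 := mul_le_mul_of_nonneg_right (card_filter_ipwb_le_fo m (fun ω => visits m ω = 2)) (pow_nonneg hy 2)
  have hN3 := mul_le_mul_of_nonneg_right (card_filter_ipwb_le_fo m (fun ω => visits m ω = 3)) (pow_nonneg hy 3)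
  have hN1' : (0 : ℝ) ≤ #((ipwb m).filter fun ω => visits m ω = 1) * y := mul_nonneg (Nat.cast_nonneg _) hy
  have hN2' : (0 : ℝ) ≤ #((ipwb m).filter fun ω => visits m ω = 2) * y ^ 2 := mul_nonneg (Nat.cast_nonneg _) (pow_nonneg hy 2)
  have hN3' : (0 : ℝ) ≤ #((ipwb m).filter fun ω => visits m ω = 3) * y ^ 3 := mul_nonneg (Nat.cast_nonneg _) (pow_nonneg hy 3)
  rw [h3] at hN1 hN2 hN3
  constructor
  · rw [e]; push_cast; linarith [hN1', hN2', hN3']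
  · rw [e]; push_cast; linarith [hN1, hN2, hN3]

open Classical in
/-- ★ `Λ₃₈`: `N_{19,5} * y ^ 5 + 57 * y ^ 6 ≤ Λ_38(y) ≤ 3^38·(y + y ^ 2 + y ^ 3 + y ^ 4) + (the same)` for `y ≥ 0` (`visits ≤ 6` on `ipwb 38`; `57`).
[cite: MadrasSlade1993, Section 4.2, (4.2.2); Section 1.2, (1.2.16) (p. 11)] -/
theorem IPWB_thirtyeight_two_sided_fourteen {m : ℕ} (hm : m = 38) (hy : 0 ≤ y) :
    #((ipwb m).filter fun ω => visits m ω = 5) * y ^ 5 + 57 * y ^ 6 ≤ IPWB m y ∧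
      IPWB m y ≤ 3 ^ 38 * (y + y ^ 2 + y ^ 3 + y ^ 4) + #((ipwb m).filter fun ω => visits m ω = 5) * y ^ 5 + 57 * y ^ 6 := by
  have e := IPWB_eq_sum_range_card_mul_pow (m := m) (V := 6) (fun ω hω => visits_le_six_fo (by omega) (by omega) hω) y
  simp only [Finset.sum_range_succ, Finset.sum_range_zero, card_zeroVisit_ipwb_eq_zero, card_sixVisit_ipwb_thirtyeight_eq hm] at e
  have h3 : (3 : ℝ) ^ m = 3 ^ 38 := by rw [hm]
  have hN1 := mul_le_mul_of_nonneg_right (card_filter_ipwb_le_fo m (fun ω => visits m ω = 1)) hy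
  have hN2 := mul_le_mul_of_nonneg_right (card_filter_ipwb_le_fo m (fun ω => visits m ω = 2)) (pow_nonneg hy 2)
  have hN3 := mul_le_mul_of_nonneg_right (card_filter_ipwb_le_fo m (fun ω => visits m ω = 3)) (pow_nonneg hy 3)
  have hN4 := mul_le_mul_of_nonneg_right (card_filter_ipwb_le_fo m (fun ω => visits m ω = 4)) (pow_nonneg hy 4)
  have hN1' : (0 : ℝ) ≤ #((ipwb m).filter fun ω => visits m ω = 1) * y := mul_nonneg (Nat.cast_nonneg _) hy
  have hN2' : (0 : ℝ) ≤ #((ipwb m).filter fun ω => visits m ω = 2) * y ^ 2 := mul_nonneg (Nat.cast_nonneg _) (pow_nonneg hy 2)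
  have hN3' : (0 : ℝ) ≤ #((ipwb m).filter fun ω => visits m ω = 3) * y ^ 3 := mul_nonneg (Nat.cast_nonneg _) (pow_nonneg hy 3)
  have hN4' : (0 : ℝ) ≤ #((ipwb m).filter fun ω => visits m ω = 4) * y ^ 4 := mul_nonneg (Nat.cast_nonneg _) (pow_nonneg hy 4)
  rw [h3] at hN1 hN2 hN3 hN4
  constructor
  · rw [e]; push_cast; linarith [hN1', hN2', hN3', hN4']
  · rw [e]; push_cast; linarith [hN1, hN2, hN3, hN4]

open Classical in
/-- ★ `Λ₄₀`: `N_{20,6} * y ^ 6 ≤ Λ_40(y) ≤ 3^40·(y + y ^ 2 + y ^ 3 + y ^ 4 + y ^ 5) + (the same)` for `y ≥ 0` (`visits ≤ 6` on `ipwb 40`; no lower classes known exactly).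
[cite: MadrasSlade1993, Section 4.2, (4.2.2); Section 1.2, (1.2.16) (p. 11)] -/
theorem IPWB_forty_two_sided_fourteen {m : ℕ} (hm : m = 40) (hy : 0 ≤ y) :
    #((ipwb m).filter fun ω => visits m ω = 6) * y ^ 6 ≤ IPWB m y ∧
      IPWB m y ≤ 3 ^ 40 * (y + y ^ 2 + y ^ 3 + y ^ 4 + y ^ 5) + #((ipwb m).filter fun ω => visits m ω = 6) * y ^ 6 := by
  have e := IPWB_eq_sum_range_card_mul_pow (m := m) (V := 6) (fun ω hω => visits_le_six_fo (by omega) (by omega) hω) y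
  simp only [Finset.sum_range_succ, Finset.sum_range_zero, card_zeroVisit_ipwb_eq_zero] at e
  have h3 : (3 : ℝ) ^ m = 3 ^ 40 := by rw [hm]
  have hN1 := mul_le_mul_of_nonneg_right (card_filter_ipwb_le_fo m (fun ω => visits m ω = 1)) hy
  have hN2 := mul_le_mul_of_nonneg_right (card_filter_ipwb_le_fo m (fun ω => visits m ω = 2)) (pow_nonneg hy 2)
  have hN3 := mul_le_mul_of_nonneg_right (card_filter_ipwb_le_fo m (fun ω => visits m ω = 3)) (pow_nonneg hy 3)
  have hN4 := mul_le_mul_of_nonneg_right (card_filter_ipwb_le_fo m (fun ω => visits m ω = 4)) (pow_nonneg hy 4)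
  have hN5 := mul_le_mul_of_nonneg_right (card_filter_ipwb_le_fo m (fun ω => visits m ω = 5)) (pow_nonneg hy 5)
  have hN1' : (0 : ℝ) ≤ #((ipwb m).filter fun ω => visits m ω = 1) * y := mul_nonneg (Nat.cast_nonneg _) hy
  have hN2' : (0 : ℝ) ≤ #((ipwb m).filter fun ω => visits m ω = 2) * y ^ 2 := mul_nonneg (Nat.cast_nonneg _) (pow_nonneg hy 2)
  have hN3' : (0 : ℝ) ≤ #((ipwb m).filter fun ω => visits m ω = 3) * y ^ 3 := mul_nonneg (Nat.cast_nonneg _) (pow_nonneg hy 3)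
  have hN4' : (0 : ℝ) ≤ #((ipwb m).filter fun ω => visits m ω = 4) * y ^ 4 := mul_nonneg (Nat.cast_nonneg _) (pow_nonneg hy 4)
  have hN5' : (0 : ℝ) ≤ #((ipwb m).filter fun ω => visits m ω = 5) * y ^ 5 := mul_nonneg (Nat.cast_nonneg _) (pow_nonneg hy 5)
  rw [h3] at hN1 hN2 hN3 hN4 hN5
  constructor
  · rw [e]; push_cast; linarith [hN1', hN2', hN3', hN4', hN5']
  · rw [e]; push_cast; linarith [hN1, hN2, hN3, hN4, hN5]

open Classical in
/-- ★ `Λ₄₂`: `N_{21,7} * y ^ 7 ≤ Λ_42(y) ≤ 3^42·(y + y ^ 2 + y ^ 3 + y ^ 4 + y ^ 5 + y ^ 6) + (the same)` for `y ≥ 0` (`visits ≤ 7` on `ipwb 42`; no lower classes known exactly).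
[cite: MadrasSlade1993, Section 4.2, (4.2.2); Section 1.2, (1.2.16) (p. 11)] -/
theorem IPWB_fortytwo_two_sided_fourteen {m : ℕ} (hm : m = 42) (hy : 0 ≤ y) :
    #((ipwb m).filter fun ω => visits m ω = 7) * y ^ 7 ≤ IPWB m y ∧
      IPWB m y ≤ 3 ^ 42 * (y + y ^ 2 + y ^ 3 + y ^ 4 + y ^ 5 + y ^ 6) + #((ipwb m).filter fun ω => visits m ω = 7) * y ^ 7 := by
  have e := IPWB_eq_sum_range_card_mul_pow (m := m) (V := 7) (fun ω hω => visits_le_seven_fo (by omega) (by omega) hω) y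
  simp only [Finset.sum_range_succ, Finset.sum_range_zero, card_zeroVisit_ipwb_eq_zero] at e
  have h3 : (3 : ℝ) ^ m = 3 ^ 42 := by rw [hm]
  have hN1 := mul_le_mul_of_nonneg_right (card_filter_ipwb_le_fo m (fun ω => visits m ω = 1)) hy
  have hN2 := mul_le_mul_of_nonneg_right (card_filter_ipwb_le_fo m (fun ω => visits m ω = 2)) (pow_nonneg hy 2)
  have hN3 := mul_le_mul_of_nonneg_right (card_filter_ipwb_le_fo m (fun ω => visits m ω = 3)) (pow_nonneg hy 3)
  have hN4 := mul_le_mul_of_nonneg_right (card_filter_ipwb_le_fo m (fun ω => visits m ω = 4)) (pow_nonneg hy 4)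
  have hN5 := mul_le_mul_of_nonneg_right (card_filter_ipwb_le_fo m (fun ω => visits m ω = 5)) (pow_nonneg hy 5)
  have hN6 := mul_le_mul_of_nonneg_right (card_filter_ipwb_le_fo m (fun ω => visits m ω = 6)) (pow_nonneg hy 6)
  have hN1' : (0 : ℝ) ≤ #((ipwb m).filter fun ω => visits m ω = 1) * y := mul_nonneg (Nat.cast_nonneg _) hy
  have hN2' : (0 : ℝ) ≤ #((ipwb m).filter fun ω => visits m ω = 2) * y ^ 2 := mul_nonneg (Nat.cast_nonneg _) (pow_nonneg hy 2)
  have hN3' : (0 : ℝ) ≤ #((ipwb m).filter fun ω => visits m ω = 3) * y ^ 3 := mul_nonneg (Nat.cast_nonneg _) (pow_nonneg hy 3)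
  have hN4' : (0 : ℝ) ≤ #((ipwb m).filter fun ω => visits m ω = 4) * y ^ 4 := mul_nonneg (Nat.cast_nonneg _) (pow_nonneg hy 4)
  have hN5' : (0 : ℝ) ≤ #((ipwb m).filter fun ω => visits m ω = 5) * y ^ 5 := mul_nonneg (Nat.cast_nonneg _) (pow_nonneg hy 5)
  have hN6' : (0 : ℝ) ≤ #((ipwb m).filter fun ω => visits m ω = 6) * y ^ 6 := mul_nonneg (Nat.cast_nonneg _) (pow_nonneg hy 6)
  rw [h3] at hN1 hN2 hN3 hN4 hN5 hN6
  constructor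
  · rw [e]; push_cast; linarith [hN1', hN2', hN3', hN4', hN5', hN6']
  · rw [e]; push_cast; linarith [hN1, hN2, hN3, hN4, hN5, hN6]

/-- ★ `Λ₄₄(y) ≤ 3⁴⁴(y + y² + y³ + y⁴ + y⁵ + y⁶ + y⁷)` for `y ≥ 0` (`1 ≤ visits ≤ 7` on `ipwb 44`). [cite: MadrasSlade1993, Section 4.2, (4.2.2); Section 1.2, (1.2.16) (p. 11)] -/
theorem IPWB_fortyfour_le {m : ℕ} (hm : m = 44) (hy : 0 ≤ y) : IPWB m y ≤ 3 ^ 44 * (y + y ^ 2 + y ^ 3 + y ^ 4 + y ^ 5 + y ^ 6 + y ^ 7) := by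
  classical
  have hterm : ∀ ω ∈ ipwb m, y ^ visits m ω ≤ y + y ^ 2 + y ^ 3 + y ^ 4 + y ^ 5 + y ^ 6 + y ^ 7 := by
    intro ω hω
    have h1 := one_le_visits_of_mem_ipwb hω
    have h7 : visits m ω ≤ 7 := visits_le_seven_fo (by omega) (by omega) hω
    have hy2 : 0 ≤ y ^ 2 := pow_nonneg hy 2
    have hy3 : 0 ≤ y ^ 3 := pow_nonneg hy 3
    have hy4 : 0 ≤ y ^ 4 := pow_nonneg hy 4
    have hy5 : 0 ≤ y ^ 5 := pow_nonneg hy 5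
    have hy6 : 0 ≤ y ^ 6 := pow_nonneg hy 6
    have hy7 : 0 ≤ y ^ 7 := pow_nonneg hy 7
    rcases Nat.lt_or_ge (visits m ω) 2 with hv | hv
    · rw [show visits m ω = 1 by omega, pow_one]; linarith
    rcases Nat.lt_or_ge (visits m ω) 3 with hv' | hv'
    · rw [show visits m ω = 2 by omega]; linarith
    rcases Nat.lt_or_ge (visits m ω) 4 with hv'' | hv''
    · rw [show visits m ω = 3 by omega]; linarith
    rcases Nat.lt_or_ge (visits m ω) 5 with hv3 | hv3
    · rw [show visits m ω = 4 by omega]; linarith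
    rcases Nat.lt_or_ge (visits m ω) 6 with hv4 | hv4
    · rw [show visits m ω = 5 by omega]; linarith
    rcases Nat.lt_or_ge (visits m ω) 7 with hv5 | hv5
    · rw [show visits m ω = 6 by omega]; linarith
    · rw [show visits m ω = 7 by omega]; linarith
  calc IPWB m y = ∑ ω ∈ ipwb m, y ^ visits m ω := rfl
    _ ≤ ∑ _ω ∈ ipwb m, (y + y ^ 2 + y ^ 3 + y ^ 4 + y ^ 5 + y ^ 6 + y ^ 7) := Finset.sum_le_sum hterm
    _ = #(ipwb m) * (y + y ^ 2 + y ^ 3 + y ^ 4 + y ^ 5 + y ^ 6 + y ^ 7) := by rw [Finset.sum_const, nsmul_eq_mul]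
    _ ≤ 3 ^ m * (y + y ^ 2 + y ^ 3 + y ^ 4 + y ^ 5 + y ^ 6 + y ^ 7) := mul_le_mul_of_nonneg_right (card_ipwb_le_three_pow m) (by positivity)
    _ = 3 ^ 44 * (y + y ^ 2 + y ^ 3 + y ^ 4 + y ^ 5 + y ^ 6 + y ^ 7) := by rw [hm]

/-! ### §2  Kesten's identity at order fourteen: the head sandwich with symbolic diagonal-fourteen class numbers -/

/-- The exact laws `f₀, f₂, …, f₁₄` (tree through «CENSUS-THIRTEEN-A»). [cite: MadrasSlade1993, §4.2, (4.2.2) (p. 91)] -/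
private theorem head_laws_fo (y : ℝ) :
    pwbLaw y 0 = 0 ∧ pwbLaw y 2 = 0 ∧ pwbLaw y 3 = y / wallRate y ^ 6 ∧ pwbLaw y 4 = y / wallRate y ^ 8 ∧ pwbLaw y 5 = 3 * y / wallRate y ^ 10 ∧
      pwbLaw y 6 = (6 * y + y ^ 2) / wallRate y ^ 12 ∧ pwbLaw y 7 = (15 * y + 3 * y ^ 2) / wallRate y ^ 14 ∧
      pwbLaw y 8 = (38 * y + 11 * y ^ 2) / wallRate y ^ 16 ∧ pwbLaw y 9 = (98 * y + 34 * y ^ 2 + y ^ 3) / wallRate y ^ 18 ∧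
      pwbLaw y 10 = (267 * y + 99 * y ^ 2 + 7 * y ^ 3) / wallRate y ^ 20 ∧ pwbLaw y 11 = (738 * y + 295 * y ^ 2 + 33 * y ^ 3) / wallRate y ^ 22 ∧
      pwbLaw y 12 = (2085 * y + 860 * y ^ 2 + 132 * y ^ 3 + y ^ 4) / wallRate y ^ 24 ∧
      pwbLaw y 13 = (5975 * y + 2579 * y ^ 2 + 468 * y ^ 3 + 16 * y ^ 4) / wallRate y ^ 26 ∧
      pwbLaw y 14 = (17356 * y + 7718 * y ^ 2 + 1585 * y ^ 3 + 95 * y ^ 4) / wallRate y ^ 28 := by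
  refine ⟨pwbLaw_zero, ?_, ?_, ?_, ?_, ?_, ?_, ?_, ?_, ?_, pwbLaw_eleven_eq_exact y, ?_, ?_, ?_⟩
  · rw [pwbLaw_eq_fo 2 (m := 4) rfl, IPWB_four rfl, zero_div]
  · rw [pwbLaw_eq_fo 3 (m := 6) rfl, IPWB_six rfl]
  · rw [pwbLaw_eq_fo 4 (m := 8) rfl, IPWB_eight_eq rfl]
  · rw [pwbLaw_eq_fo 5 (m := 10) rfl, IPWB_ten_eq rfl]
  · rw [pwbLaw_eq_fo 6 (m := 12) rfl, IPWB_twelve_eq_six rfl]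
  · rw [pwbLaw_eq_fo 7 (m := 14) rfl, IPWB_fourteen_eq_fifteen rfl]
  · rw [pwbLaw_eq_fo 8 (m := 16) rfl, IPWB_sixteen_eq_thirtyEight rfl]
  · rw [pwbLaw_eq_fo 9 (m := 18) rfl, IPWB_eighteen_eq_ninetyEight rfl]
  · rw [pwbLaw_eq_fo 10 (m := 20) rfl, IPWB_twenty_eq_twoSixtySeven rfl]
  · rw [pwbLaw_eq_fo 12 (m := 24) rfl, IPWB_twentyfour_eq_census_eleven rfl, card_oneVisit_ipwb_twentyfour_eq rfl]; push_cast; ring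
  · rw [pwbLaw_eq_fo 13 (m := 26) rfl, IPWB_twentysix_eq_census_twelve rfl, card_oneVisit_ipwb_twentysix_eq rfl]; push_cast; ring
  · rw [pwbLaw_eq_fo 14 (m := 28) rfl, IPWB_twentyeight_eq_census_thirteen rfl, card_oneVisit_ipwb_twentyeight_eq rfl]; push_cast; ring

set_option maxRecDepth 4096 in
open Classical in
/-- ★ **The head from above** (`y ≥ 0`): `Σ_{k ≤ 22} f_k(y) ≤ H₁₄(y) + CRUDE₁₄(y)`. [cite: MadrasSlade1993, §4.2, (4.2.2), (4.2.4) (p. 91)] -/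
theorem sum_pwbLaw_range_twentythree_le {m₁ m₂ m₃ m₄ m₅ m₆ m₇ : ℕ} (h₁ : m₁ = 30) (h₂ : m₂ = 32) (h₃ : m₃ = 34) (h₄ : m₄ = 36) (h₅ : m₅ = 38) (h₆ : m₆ = 40) (h₇ : m₇ = 42) (hy : 0 ≤ y) :
    ∑ k ∈ range 23, pwbLaw y k ≤
      (y / wallRate y ^ 2 + y / wallRate y ^ 6 + y / wallRate y ^ 8 + 3 * y / wallRate y ^ 10 +
        (6 * y + y ^ 2) / wallRate y ^ 12 + (15 * y + 3 * y ^ 2) / wallRate y ^ 14 + (38 * y + 11 * y ^ 2) / wallRate y ^ 16 +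
        (98 * y + 34 * y ^ 2 + y ^ 3) / wallRate y ^ 18 + (267 * y + 99 * y ^ 2 + 7 * y ^ 3) / wallRate y ^ 20 +
        (738 * y + 295 * y ^ 2 + 33 * y ^ 3) / wallRate y ^ 22 + (2085 * y + 860 * y ^ 2 + 132 * y ^ 3 + y ^ 4) / wallRate y ^ 24 +
        (5975 * y + 2579 * y ^ 2 + 468 * y ^ 3 + 16 * y ^ 4) / wallRate y ^ 26 +
        (17356 * y + 7718 * y ^ 2 + 1585 * y ^ 3 + 95 * y ^ 4) / wallRate y ^ 28 +
        (#((ipwb m₁).filter fun ω => visits m₁ ω = 1) * y + 23296 * y ^ 2 + 5219 * y ^ 3 + 486 * y ^ 4 + y ^ 5) / wallRate y ^ 30 +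
        (#((ipwb m₂).filter fun ω => visits m₂ ω = 2) * y ^ 2 + 17048 * y ^ 3 + 2018 * y ^ 4 + 32 * y ^ 5) / wallRate y ^ 32 +
        (#((ipwb m₃).filter fun ω => visits m₃ ω = 3) * y ^ 3 + 7839 * y ^ 4 + 260 * y ^ 5) / wallRate y ^ 34 +
        (#((ipwb m₄).filter fun ω => visits m₄ ω = 4) * y ^ 4 + 1627 * y ^ 5 + y ^ 6) / wallRate y ^ 36 +
        (#((ipwb m₅).filter fun ω => visits m₅ ω = 5) * y ^ 5 + 57 * y ^ 6) / wallRate y ^ 38 + #((ipwb m₆).filter fun ω => visits m₆ ω = 6) * y ^ 6 / wallRate y ^ 40 + #((ipwb m₇).filter fun ω => visits m₇ ω = 7) * y ^ 7 / wallRate y ^ 42) +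
      (3 ^ 32 * y / wallRate y ^ 32 + 3 ^ 34 * (y + y ^ 2) / wallRate y ^ 34 + 3 ^ 36 * (y + y ^ 2 + y ^ 3) / wallRate y ^ 36 +
          3 ^ 38 * (y + y ^ 2 + y ^ 3 + y ^ 4) / wallRate y ^ 38 + 3 ^ 40 * (y + y ^ 2 + y ^ 3 + y ^ 4 + y ^ 5) / wallRate y ^ 40 +
          3 ^ 42 * (y + y ^ 2 + y ^ 3 + y ^ 4 + y ^ 5 + y ^ 6) / wallRate y ^ 42 +
          3 ^ 44 * (y + y ^ 2 + y ^ 3 + y ^ 4 + y ^ 5 + y ^ 6 + y ^ 7) / wallRate y ^ 44) := by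
  subst h₁ h₂ h₃ h₄ h₅ h₆ h₇
  have hβ := wallRate_pos y
  obtain ⟨e0, e2, e3, e4, e5, e6, e7, e8, e9, e10, e11, e12, e13, e14⟩ := head_laws_fo y
  have e15 : pwbLaw y 15 = (#((ipwb 30).filter fun ω => visits 30 ω = 1) * y + 23296 * y ^ 2 + 5219 * y ^ 3 + 486 * y ^ 4 + y ^ 5) / wallRate y ^ 30 := by
    rw [pwbLaw_eq_fo 15 (m := 30) rfl, IPWB_thirty_eq_census_fourteen rfl]
  have e16 : pwbLaw y 16 ≤ (#((ipwb 32).filter fun ω => visits 32 ω = 2) * y ^ 2 + 17048 * y ^ 3 + 2018 * y ^ 4 + 32 * y ^ 5) / wallRate y ^ 32 + 3 ^ 32 * y / wallRate y ^ 32 := by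
    rw [pwbLaw_eq_fo 16 (m := 32) rfl, ← add_div]
    refine div_le_div_of_nonneg_right ?_ (pow_pos hβ 32).le
    have h := (IPWB_thirtytwo_two_sided_fourteen (m := 32) rfl hy).2
    linarith
  have e17 : pwbLaw y 17 ≤ (#((ipwb 34).filter fun ω => visits 34 ω = 3) * y ^ 3 + 7839 * y ^ 4 + 260 * y ^ 5) / wallRate y ^ 34 + 3 ^ 34 * (y + y ^ 2) / wallRate y ^ 34 := by
    rw [pwbLaw_eq_fo 17 (m := 34) rfl, ← add_div]
    refine div_le_div_of_nonneg_right ?_ (pow_pos hβ 34).le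
    have h := (IPWB_thirtyfour_two_sided_fourteen (m := 34) rfl hy).2
    linarith
  have e18 : pwbLaw y 18 ≤ (#((ipwb 36).filter fun ω => visits 36 ω = 4) * y ^ 4 + 1627 * y ^ 5 + y ^ 6) / wallRate y ^ 36 + 3 ^ 36 * (y + y ^ 2 + y ^ 3) / wallRate y ^ 36 := by
    rw [pwbLaw_eq_fo 18 (m := 36) rfl, ← add_div]
    refine div_le_div_of_nonneg_right ?_ (pow_pos hβ 36).le
    have h := (IPWB_thirtysix_two_sided_fourteen (m := 36) rfl hy).2
    linarith
  have e19 : pwbLaw y 19 ≤ (#((ipwb 38).filter fun ω => visits 38 ω = 5) * y ^ 5 + 57 * y ^ 6) / wallRate y ^ 38 + 3 ^ 38 * (y + y ^ 2 + y ^ 3 + y ^ 4) / wallRate y ^ 38 := by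
    rw [pwbLaw_eq_fo 19 (m := 38) rfl, ← add_div]
    refine div_le_div_of_nonneg_right ?_ (pow_pos hβ 38).le
    have h := (IPWB_thirtyeight_two_sided_fourteen (m := 38) rfl hy).2
    linarith
  have e20 : pwbLaw y 20 ≤ (#((ipwb 40).filter fun ω => visits 40 ω = 6) * y ^ 6) / wallRate y ^ 40 + 3 ^ 40 * (y + y ^ 2 + y ^ 3 + y ^ 4 + y ^ 5) / wallRate y ^ 40 := by
    rw [pwbLaw_eq_fo 20 (m := 40) rfl, ← add_div]
    refine div_le_div_of_nonneg_right ?_ (pow_pos hβ 40).le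
    have h := (IPWB_forty_two_sided_fourteen (m := 40) rfl hy).2
    linarith
  have e21 : pwbLaw y 21 ≤ (#((ipwb 42).filter fun ω => visits 42 ω = 7) * y ^ 7) / wallRate y ^ 42 + 3 ^ 42 * (y + y ^ 2 + y ^ 3 + y ^ 4 + y ^ 5 + y ^ 6) / wallRate y ^ 42 := by
    rw [pwbLaw_eq_fo 21 (m := 42) rfl, ← add_div]
    refine div_le_div_of_nonneg_right ?_ (pow_pos hβ 42).le
    have h := (IPWB_fortytwo_two_sided_fourteen (m := 42) rfl hy).2
    linarith
  have e22 : pwbLaw y 22 ≤ 3 ^ 44 * (y + y ^ 2 + y ^ 3 + y ^ 4 + y ^ 5 + y ^ 6 + y ^ 7) / wallRate y ^ 44 := by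
    rw [pwbLaw_eq_fo 22 (m := 44) rfl]
    exact div_le_div_of_nonneg_right (IPWB_fortyfour_le rfl hy) (pow_pos hβ 44).le
  have e1 := pwbLaw_one_le_div_fo hy
  simp only [Finset.sum_range_succ, Finset.sum_range_zero, e0, e2, e3, e4, e5, e6, e7, e8, e9, e10, e11, e12, e13, e14, e15]
  linarith

set_option maxRecDepth 4096 in
open Classical in
/-- ★ **The head from below** (`y > 0`): `H₁₄(y) ≤ Σ_{k ≤ 22} f_k(y)`. [cite: MadrasSlade1993, §4.2, (4.2.2), (4.2.4) (p. 91)] -/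
theorem head_le_sum_pwbLaw_range_twentythree {m₁ m₂ m₃ m₄ m₅ m₆ m₇ : ℕ} (h₁ : m₁ = 30) (h₂ : m₂ = 32) (h₃ : m₃ = 34) (h₄ : m₄ = 36) (h₅ : m₅ = 38) (h₆ : m₆ = 40) (h₇ : m₇ = 42) (hy : 0 < y) :
    y / wallRate y ^ 2 + y / wallRate y ^ 6 + y / wallRate y ^ 8 + 3 * y / wallRate y ^ 10 +
        (6 * y + y ^ 2) / wallRate y ^ 12 + (15 * y + 3 * y ^ 2) / wallRate y ^ 14 + (38 * y + 11 * y ^ 2) / wallRate y ^ 16 +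
        (98 * y + 34 * y ^ 2 + y ^ 3) / wallRate y ^ 18 + (267 * y + 99 * y ^ 2 + 7 * y ^ 3) / wallRate y ^ 20 +
        (738 * y + 295 * y ^ 2 + 33 * y ^ 3) / wallRate y ^ 22 + (2085 * y + 860 * y ^ 2 + 132 * y ^ 3 + y ^ 4) / wallRate y ^ 24 +
        (5975 * y + 2579 * y ^ 2 + 468 * y ^ 3 + 16 * y ^ 4) / wallRate y ^ 26 +
        (17356 * y + 7718 * y ^ 2 + 1585 * y ^ 3 + 95 * y ^ 4) / wallRate y ^ 28 +
        (#((ipwb m₁).filter fun ω => visits m₁ ω = 1) * y + 23296 * y ^ 2 + 5219 * y ^ 3 + 486 * y ^ 4 + y ^ 5) / wallRate y ^ 30 +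
        (#((ipwb m₂).filter fun ω => visits m₂ ω = 2) * y ^ 2 + 17048 * y ^ 3 + 2018 * y ^ 4 + 32 * y ^ 5) / wallRate y ^ 32 +
        (#((ipwb m₃).filter fun ω => visits m₃ ω = 3) * y ^ 3 + 7839 * y ^ 4 + 260 * y ^ 5) / wallRate y ^ 34 +
        (#((ipwb m₄).filter fun ω => visits m₄ ω = 4) * y ^ 4 + 1627 * y ^ 5 + y ^ 6) / wallRate y ^ 36 +
        (#((ipwb m₅).filter fun ω => visits m₅ ω = 5) * y ^ 5 + 57 * y ^ 6) / wallRate y ^ 38 + #((ipwb m₆).filter fun ω => visits m₆ ω = 6) * y ^ 6 / wallRate y ^ 40 + #((ipwb m₇).filter fun ω => visits m₇ ω = 7) * y ^ 7 / wallRate y ^ 42 ≤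
      ∑ k ∈ range 23, pwbLaw y k := by
  subst h₁ h₂ h₃ h₄ h₅ h₆ h₇
  have hβ := wallRate_pos y
  obtain ⟨e0, e2, e3, e4, e5, e6, e7, e8, e9, e10, e11, e12, e13, e14⟩ := head_laws_fo y
  have e15 : pwbLaw y 15 = (#((ipwb 30).filter fun ω => visits 30 ω = 1) * y + 23296 * y ^ 2 + 5219 * y ^ 3 + 486 * y ^ 4 + y ^ 5) / wallRate y ^ 30 := by
    rw [pwbLaw_eq_fo 15 (m := 30) rfl, IPWB_thirty_eq_census_fourteen rfl]
  have e16 : (#((ipwb 32).filter fun ω => visits 32 ω = 2) * y ^ 2 + 17048 * y ^ 3 + 2018 * y ^ 4 + 32 * y ^ 5) / wallRate y ^ 32 ≤ pwbLaw y 16 := by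
    rw [pwbLaw_eq_fo 16 (m := 32) rfl]
    exact div_le_div_of_nonneg_right (IPWB_thirtytwo_two_sided_fourteen (m := 32) rfl hy.le).1 (pow_pos hβ 32).le
  have e17 : (#((ipwb 34).filter fun ω => visits 34 ω = 3) * y ^ 3 + 7839 * y ^ 4 + 260 * y ^ 5) / wallRate y ^ 34 ≤ pwbLaw y 17 := by
    rw [pwbLaw_eq_fo 17 (m := 34) rfl]
    exact div_le_div_of_nonneg_right (IPWB_thirtyfour_two_sided_fourteen (m := 34) rfl hy.le).1 (pow_pos hβ 34).le
  have e18 : (#((ipwb 36).filter fun ω => visits 36 ω = 4) * y ^ 4 + 1627 * y ^ 5 + y ^ 6) / wallRate y ^ 36 ≤ pwbLaw y 18 := by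
    rw [pwbLaw_eq_fo 18 (m := 36) rfl]
    exact div_le_div_of_nonneg_right (IPWB_thirtysix_two_sided_fourteen (m := 36) rfl hy.le).1 (pow_pos hβ 36).le
  have e19 : (#((ipwb 38).filter fun ω => visits 38 ω = 5) * y ^ 5 + 57 * y ^ 6) / wallRate y ^ 38 ≤ pwbLaw y 19 := by
    rw [pwbLaw_eq_fo 19 (m := 38) rfl]
    exact div_le_div_of_nonneg_right (IPWB_thirtyeight_two_sided_fourteen (m := 38) rfl hy.le).1 (pow_pos hβ 38).le
  have e20 : (#((ipwb 40).filter fun ω => visits 40 ω = 6) * y ^ 6) / wallRate y ^ 40 ≤ pwbLaw y 20 := by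
    rw [pwbLaw_eq_fo 20 (m := 40) rfl]
    exact div_le_div_of_nonneg_right (IPWB_forty_two_sided_fourteen (m := 40) rfl hy.le).1 (pow_pos hβ 40).le
  have e21 : (#((ipwb 42).filter fun ω => visits 42 ω = 7) * y ^ 7) / wallRate y ^ 42 ≤ pwbLaw y 21 := by
    rw [pwbLaw_eq_fo 21 (m := 42) rfl]
    exact div_le_div_of_nonneg_right (IPWB_fortytwo_two_sided_fourteen (m := 42) rfl hy.le).1 (pow_pos hβ 42).le
  have e22 : 0 ≤ pwbLaw y 22 := pwbLaw_nonneg hy.le 22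
  have e1 := div_sq_wallRate_le_pwbLaw_one hy
  simp only [Finset.sum_range_succ, Finset.sum_range_zero, e0, e2, e3, e4, e5, e6, e7, e8, e9, e10, e11, e12, e13, e14, e15]
  linarith

/-- `Σ_{k ≤ n} f_k(y) ≤ 1` for `y > μ³`. [cite: MadrasSlade1993, §4.2, (4.2.4), Theorem 4.2.2 (pp. 91–92)] -/
private theorem sum_pwbLaw_range_le_one_fo (hy : hexConnectiveConstant ^ 3 < y) (n : ℕ) :
    ∑ k ∈ range n, pwbLaw y k ≤ 1 := by
  have hμ := hexConnectiveConstant_pos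
  have hy0 : 0 < y := lt_of_le_of_lt (by positivity) hy
  exact sum_le_hasSum (range n) (fun k _ => pwbLaw_nonneg hy0.le k) (hasSum_pwbLaw_of_cube_lt hy)

set_option maxRecDepth 4096 in
set_option maxHeartbeats 800000 in
open Classical in
/-- ★★ **The order-fourteen head sandwich** for `y > μ³`: `1 − Aθ₃^{22} − CRUDE₁₄(y) ≤ H₁₄(y) ≤ 1` (tail at `n = 22`: `θ₃^{22} ≍ y^{−44/3} = o(y⁻¹⁴)`; crude `O(y⁻¹⁵)`).
[cite: MadrasSlade1993, §4.2, (4.2.2), (4.2.4), Theorem 4.2.2 (pp. 91–92)] [cite: Kesten1963SAW, §4] -/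
theorem kesten_head_fourteen_sandwich_of_cube_lt {m₁ m₂ m₃ m₄ m₅ m₆ m₇ : ℕ} (h₁ : m₁ = 30) (h₂ : m₂ = 32) (h₃ : m₃ = 34) (h₄ : m₄ = 36) (h₅ : m₅ = 38) (h₆ : m₆ = 40) (h₇ : m₇ = 42)
    (hy : hexConnectiveConstant ^ 3 < y) :
    1 - (hexConnectiveConstant ^ 2 + y ^ ((2 : ℝ) / 3) / hexConnectiveConstant ^ 2) *
          (hexConnectiveConstant ^ 2 / y ^ ((2 : ℝ) / 3)) / (1 - hexConnectiveConstant ^ 2 / y ^ ((2 : ℝ) / 3)) *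
          (hexConnectiveConstant ^ 2 / y ^ ((2 : ℝ) / 3)) ^ 22 -
        (3 ^ 32 * y / wallRate y ^ 32 + 3 ^ 34 * (y + y ^ 2) / wallRate y ^ 34 + 3 ^ 36 * (y + y ^ 2 + y ^ 3) / wallRate y ^ 36 +
          3 ^ 38 * (y + y ^ 2 + y ^ 3 + y ^ 4) / wallRate y ^ 38 + 3 ^ 40 * (y + y ^ 2 + y ^ 3 + y ^ 4 + y ^ 5) / wallRate y ^ 40 +
          3 ^ 42 * (y + y ^ 2 + y ^ 3 + y ^ 4 + y ^ 5 + y ^ 6) / wallRate y ^ 42 +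
          3 ^ 44 * (y + y ^ 2 + y ^ 3 + y ^ 4 + y ^ 5 + y ^ 6 + y ^ 7) / wallRate y ^ 44) ≤
      y / wallRate y ^ 2 + y / wallRate y ^ 6 + y / wallRate y ^ 8 + 3 * y / wallRate y ^ 10 +
        (6 * y + y ^ 2) / wallRate y ^ 12 + (15 * y + 3 * y ^ 2) / wallRate y ^ 14 + (38 * y + 11 * y ^ 2) / wallRate y ^ 16 +
        (98 * y + 34 * y ^ 2 + y ^ 3) / wallRate y ^ 18 + (267 * y + 99 * y ^ 2 + 7 * y ^ 3) / wallRate y ^ 20 +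
        (738 * y + 295 * y ^ 2 + 33 * y ^ 3) / wallRate y ^ 22 + (2085 * y + 860 * y ^ 2 + 132 * y ^ 3 + y ^ 4) / wallRate y ^ 24 +
        (5975 * y + 2579 * y ^ 2 + 468 * y ^ 3 + 16 * y ^ 4) / wallRate y ^ 26 +
        (17356 * y + 7718 * y ^ 2 + 1585 * y ^ 3 + 95 * y ^ 4) / wallRate y ^ 28 +
        (#((ipwb m₁).filter fun ω => visits m₁ ω = 1) * y + 23296 * y ^ 2 + 5219 * y ^ 3 + 486 * y ^ 4 + y ^ 5) / wallRate y ^ 30 +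
        (#((ipwb m₂).filter fun ω => visits m₂ ω = 2) * y ^ 2 + 17048 * y ^ 3 + 2018 * y ^ 4 + 32 * y ^ 5) / wallRate y ^ 32 +
        (#((ipwb m₃).filter fun ω => visits m₃ ω = 3) * y ^ 3 + 7839 * y ^ 4 + 260 * y ^ 5) / wallRate y ^ 34 +
        (#((ipwb m₄).filter fun ω => visits m₄ ω = 4) * y ^ 4 + 1627 * y ^ 5 + y ^ 6) / wallRate y ^ 36 +
        (#((ipwb m₅).filter fun ω => visits m₅ ω = 5) * y ^ 5 + 57 * y ^ 6) / wallRate y ^ 38 + #((ipwb m₆).filter fun ω => visits m₆ ω = 6) * y ^ 6 / wallRate y ^ 40 + #((ipwb m₇).filter fun ω => visits m₇ ω = 7) * y ^ 7 / wallRate y ^ 42 ∧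
    y / wallRate y ^ 2 + y / wallRate y ^ 6 + y / wallRate y ^ 8 + 3 * y / wallRate y ^ 10 +
        (6 * y + y ^ 2) / wallRate y ^ 12 + (15 * y + 3 * y ^ 2) / wallRate y ^ 14 + (38 * y + 11 * y ^ 2) / wallRate y ^ 16 +
        (98 * y + 34 * y ^ 2 + y ^ 3) / wallRate y ^ 18 + (267 * y + 99 * y ^ 2 + 7 * y ^ 3) / wallRate y ^ 20 +
        (738 * y + 295 * y ^ 2 + 33 * y ^ 3) / wallRate y ^ 22 + (2085 * y + 860 * y ^ 2 + 132 * y ^ 3 + y ^ 4) / wallRate y ^ 24 +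
        (5975 * y + 2579 * y ^ 2 + 468 * y ^ 3 + 16 * y ^ 4) / wallRate y ^ 26 +
        (17356 * y + 7718 * y ^ 2 + 1585 * y ^ 3 + 95 * y ^ 4) / wallRate y ^ 28 +
        (#((ipwb m₁).filter fun ω => visits m₁ ω = 1) * y + 23296 * y ^ 2 + 5219 * y ^ 3 + 486 * y ^ 4 + y ^ 5) / wallRate y ^ 30 +
        (#((ipwb m₂).filter fun ω => visits m₂ ω = 2) * y ^ 2 + 17048 * y ^ 3 + 2018 * y ^ 4 + 32 * y ^ 5) / wallRate y ^ 32 +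
        (#((ipwb m₃).filter fun ω => visits m₃ ω = 3) * y ^ 3 + 7839 * y ^ 4 + 260 * y ^ 5) / wallRate y ^ 34 +
        (#((ipwb m₄).filter fun ω => visits m₄ ω = 4) * y ^ 4 + 1627 * y ^ 5 + y ^ 6) / wallRate y ^ 36 +
        (#((ipwb m₅).filter fun ω => visits m₅ ω = 5) * y ^ 5 + 57 * y ^ 6) / wallRate y ^ 38 + #((ipwb m₆).filter fun ω => visits m₆ ω = 6) * y ^ 6 / wallRate y ^ 40 + #((ipwb m₇).filter fun ω => visits m₇ ω = 7) * y ^ 7 / wallRate y ^ 42 ≤ 1 := by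
  have hμ := hexConnectiveConstant_pos
  have hy0 : 0 < y := lt_of_le_of_lt (by positivity) hy
  have htail := one_sub_sum_pwbLaw_le_of_cube_lt hy 22
  have hup := sum_pwbLaw_range_twentythree_le h₁ h₂ h₃ h₄ h₅ h₆ h₇ hy0.le
  have hlow := head_le_sum_pwbLaw_range_twentythree h₁ h₂ h₃ h₄ h₅ h₆ h₇ hy0
  have hone := sum_pwbLaw_range_le_one_fo hy 23
  constructor
  · linarith
  · linarith

/-! ### §3  The tail is negligible at order fourteen: `y¹³ β² (Aθ₃^{22} + CRUDE₁₄) → 0` -/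

set_option maxRecDepth 4096 in
/-- ★ The envelope part: `y¹⁴ · Aθ₃^{22} → 0` (`= μ^{44} · (1 + μ⁴/y^{2/3})/(1 − μ²/y^{2/3}) · y^{−2/3}`). [cite: MadrasSlade1993, Section 4.2, remark before (4.2.21) (p. 94)] -/
theorem tendsto_pow_fourteen_mul_envelope_tail :
    Tendsto (fun y : ℝ => y ^ 14 *
      ((hexConnectiveConstant ^ 2 + y ^ ((2 : ℝ) / 3) / hexConnectiveConstant ^ 2) *
          (hexConnectiveConstant ^ 2 / y ^ ((2 : ℝ) / 3)) / (1 - hexConnectiveConstant ^ 2 / y ^ ((2 : ℝ) / 3)) *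
          (hexConnectiveConstant ^ 2 / y ^ ((2 : ℝ) / 3)) ^ 22)) atTop (𝓝 0) := by
  have hμ := hexConnectiveConstant_pos
  have hs : Tendsto (fun y : ℝ => y ^ ((2 : ℝ) / 3)) atTop atTop := tendsto_rpow_atTop (by norm_num)
  have hc : Tendsto (fun y : ℝ => (y ^ ((2 : ℝ) / 3))⁻¹) atTop (𝓝 0) := hs.inv_tendsto_atTop
  have hA : Tendsto (fun y : ℝ => (hexConnectiveConstant ^ 4 / y ^ ((2 : ℝ) / 3) + 1) /
      (1 - hexConnectiveConstant ^ 2 / y ^ ((2 : ℝ) / 3))) atTop (𝓝 ((0 + 1) / (1 - 0))) :=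
    ((tendsto_const_nhds.div_atTop hs).add tendsto_const_nhds).div
      (tendsto_const_nhds.sub (tendsto_const_nhds.div_atTop hs)) (by norm_num)
  have h := (hA.const_mul (hexConnectiveConstant ^ 44)).mul hc
  rw [show hexConnectiveConstant ^ 44 * ((0 + 1) / (1 - 0)) * (0 : ℝ) = 0 by ring] at h
  refine h.congr' ?_
  filter_upwards [eventually_gt_atTop (hexConnectiveConstant ^ 3)] with y hy
  have hy0 : 0 < y := lt_of_le_of_lt (by positivity) hy
  have hs0 : 0 < y ^ ((2 : ℝ) / 3) := Real.rpow_pos_of_pos hy0 _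
  have hθ := theta_cube_lt_one hy
  have hD : 1 - hexConnectiveConstant ^ 2 / y ^ ((2 : ℝ) / 3) ≠ 0 := by linarith
  have hD' : y ^ ((2 : ℝ) / 3) - hexConnectiveConstant ^ 2 ≠ 0 := by
    intro h0
    apply hD
    rw [sub_eq_zero] at h0
    rw [← h0, div_self hs0.ne', sub_self]
  rw [div_pow, ← pow_mul, show 2 * 22 = 44 by norm_num, rpow_two_thirds_pow_twentytwo_fo hy0]
  field_simp

set_option maxRecDepth 4096 in
/-- ★ The crude-count part: `y¹⁴ · CRUDE₁₄(y) → 0`. [cite: BeatonBousquetMelouDeGierDuminilCopinGuttmann2014, Section 3.1, Proposition 5 (arXiv v5 p. 9)] -/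
theorem tendsto_pow_fourteen_mul_crude_tail :
    Tendsto (fun y : ℝ => y ^ 14 * (3 ^ 32 * y / wallRate y ^ 32 + 3 ^ 34 * (y + y ^ 2) / wallRate y ^ 34 + 3 ^ 36 * (y + y ^ 2 + y ^ 3) / wallRate y ^ 36 +
          3 ^ 38 * (y + y ^ 2 + y ^ 3 + y ^ 4) / wallRate y ^ 38 + 3 ^ 40 * (y + y ^ 2 + y ^ 3 + y ^ 4 + y ^ 5) / wallRate y ^ 40 +
          3 ^ 42 * (y + y ^ 2 + y ^ 3 + y ^ 4 + y ^ 5 + y ^ 6) / wallRate y ^ 42 +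
          3 ^ 44 * (y + y ^ 2 + y ^ 3 + y ^ 4 + y ^ 5 + y ^ 6 + y ^ 7) / wallRate y ^ 44)) atTop (𝓝 0) := by
  have hr := tendsto_div_sq_wallRate_fo
  have hu : Tendsto (fun y : ℝ => y⁻¹) atTop (𝓝 0) := tendsto_inv_atTop_zero
  have h := ((((((((hr.pow 16).const_mul ((3 : ℝ) ^ 32)).mul hu).add
    (((hr.pow 17).const_mul ((3 : ℝ) ^ 34)).mul ((hu.pow 2).add hu))).add
    (((hr.pow 18).const_mul ((3 : ℝ) ^ 36)).mul (((hu.pow 3).add (hu.pow 2)).add hu))).add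
    (((hr.pow 19).const_mul ((3 : ℝ) ^ 38)).mul ((((hu.pow 4).add (hu.pow 3)).add (hu.pow 2)).add hu))).add
    (((hr.pow 20).const_mul ((3 : ℝ) ^ 40)).mul (((((hu.pow 5).add (hu.pow 4)).add (hu.pow 3)).add (hu.pow 2)).add hu))).add
    (((hr.pow 21).const_mul ((3 : ℝ) ^ 42)).mul ((((((hu.pow 6).add (hu.pow 5)).add (hu.pow 4)).add (hu.pow 3)).add (hu.pow 2)).add hu))).add
    (((hr.pow 22).const_mul ((3 : ℝ) ^ 44)).mul (((((((hu.pow 7).add (hu.pow 6)).add (hu.pow 5)).add (hu.pow 4)).add (hu.pow 3)).add (hu.pow 2)).add hu))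
  refine Tendsto.congr' ?_ (tendsto_of_tendsto_of_eq_fo h (by norm_num))
  filter_upwards [eventually_gt_atTop (0 : ℝ)] with y hy
  have hB : wallRate y ≠ 0 := (wallRate_pos y).ne'
  have hy' : y ≠ 0 := hy.ne'
  field_simp

set_option maxRecDepth 4096 in
/-- ★★ **The whole tail is negligible at order fourteen**: `y¹³ β(y)² (Aθ₃^{22} + CRUDE₁₄(y)) → 0`. [cite: MadrasSlade1993, Section 4.2, Theorem 4.2.2 (pp. 91–92)] -/
theorem tendsto_pow_thirteen_mul_sq_wallRate_mul_tail_fourteen :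
    Tendsto (fun y : ℝ => y ^ 13 * wallRate y ^ 2 *
      ((hexConnectiveConstant ^ 2 + y ^ ((2 : ℝ) / 3) / hexConnectiveConstant ^ 2) *
          (hexConnectiveConstant ^ 2 / y ^ ((2 : ℝ) / 3)) / (1 - hexConnectiveConstant ^ 2 / y ^ ((2 : ℝ) / 3)) *
          (hexConnectiveConstant ^ 2 / y ^ ((2 : ℝ) / 3)) ^ 22 +
        (3 ^ 32 * y / wallRate y ^ 32 + 3 ^ 34 * (y + y ^ 2) / wallRate y ^ 34 + 3 ^ 36 * (y + y ^ 2 + y ^ 3) / wallRate y ^ 36 +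
          3 ^ 38 * (y + y ^ 2 + y ^ 3 + y ^ 4) / wallRate y ^ 38 + 3 ^ 40 * (y + y ^ 2 + y ^ 3 + y ^ 4 + y ^ 5) / wallRate y ^ 40 +
          3 ^ 42 * (y + y ^ 2 + y ^ 3 + y ^ 4 + y ^ 5 + y ^ 6) / wallRate y ^ 42 +
          3 ^ 44 * (y + y ^ 2 + y ^ 3 + y ^ 4 + y ^ 5 + y ^ 6 + y ^ 7) / wallRate y ^ 44))) atTop (𝓝 0) := by
  have h := tendsto_sq_wallRate_div_fo.mul (tendsto_pow_fourteen_mul_envelope_tail.add tendsto_pow_fourteen_mul_crude_tail)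
  rw [add_zero, mul_zero] at h
  refine h.congr' ?_
  filter_upwards [eventually_gt_atTop (0 : ℝ)] with y hy
  have hy' : y ≠ 0 := hy.ne'
  field_simp

/-! ### §4  The two-sided closed form on `y > μ³` -/

set_option maxRecDepth 4096 in
set_option maxHeartbeats 1600000 in
open Classical in
/-- ★★ **The order-fourteen two-sided closed form** for `y > μ³`: `G(y, r) ≤ T(y) ≤ G(y, r) + y¹³ β² (Aθ₃^{22} + CRUDE₁₄(y))`, `T := y¹³(β² − y − … + 109/y¹¹ + 332/y¹²)` and
`G` the order-fourteen comparison function (exact identity `T − G = y¹³β²(1 − H₁₄)`; budget line `maxHeartbeats 1600000` for the `field_simp; ring` identity).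
[cite: Kesten1963SAW, Section 4] [cite: MadrasSlade1993, Section 4.2, (4.2.2), (4.2.4), Theorem 4.2.2 (pp. 91–92)] -/
theorem fourteenth_order_two_sided_of_cube_lt {m₁ m₂ m₃ m₄ m₅ m₆ m₇ : ℕ} (h₁ : m₁ = 30) (h₂ : m₂ = 32) (h₃ : m₃ = 34) (h₄ : m₄ = 36) (h₅ : m₅ = 38) (h₆ : m₆ = 40) (h₇ : m₇ = 42)
    (hy : hexConnectiveConstant ^ 3 < y) :
    y ^ 12 * ((y / wallRate y ^ 2) ^ 2 - 1) + y ^ 11 * ((y / wallRate y ^ 2) ^ 3 - 1) +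
        y ^ 10 * (3 * (y / wallRate y ^ 2) ^ 4 + (y / wallRate y ^ 2) ^ 5 - 2) +
        y ^ 9 * (6 * (y / wallRate y ^ 2) ^ 5 + 3 * (y / wallRate y ^ 2) ^ 6 - 4) +
        y ^ 8 * (15 * (y / wallRate y ^ 2) ^ 6 + 11 * (y / wallRate y ^ 2) ^ 7 + (y / wallRate y ^ 2) ^ 8 - 6) +
        y ^ 7 * (38 * (y / wallRate y ^ 2) ^ 7 + 34 * (y / wallRate y ^ 2) ^ 8 + 7 * (y / wallRate y ^ 2) ^ 9 - 12) +
        y ^ 6 * (98 * (y / wallRate y ^ 2) ^ 8 + 99 * (y / wallRate y ^ 2) ^ 9 + 33 * (y / wallRate y ^ 2) ^ 10 + (y / wallRate y ^ 2) ^ 11 - 18) +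
        y ^ 5 * (267 * (y / wallRate y ^ 2) ^ 9 + 295 * (y / wallRate y ^ 2) ^ 10 + 132 * (y / wallRate y ^ 2) ^ 11 + 16 * (y / wallRate y ^ 2) ^ 12 - 15) +
        y ^ 4 * (738 * (y / wallRate y ^ 2) ^ 10 + 860 * (y / wallRate y ^ 2) ^ 11 + 468 * (y / wallRate y ^ 2) ^ 12 + 95 * (y / wallRate y ^ 2) ^ 13 + (y / wallRate y ^ 2) ^ 14 - 7) +
        y ^ 3 * (2085 * (y / wallRate y ^ 2) ^ 11 + 2579 * (y / wallRate y ^ 2) ^ 12 + 1585 * (y / wallRate y ^ 2) ^ 13 + 486 * (y / wallRate y ^ 2) ^ 14 + 32 * (y / wallRate y ^ 2) ^ 15 + 16) +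
        y ^ 2 * (5975 * (y / wallRate y ^ 2) ^ 12 + 7718 * (y / wallRate y ^ 2) ^ 13 + 5219 * (y / wallRate y ^ 2) ^ 14 + 2018 * (y / wallRate y ^ 2) ^ 15 + 260 * (y / wallRate y ^ 2) ^ 16 + (y / wallRate y ^ 2) ^ 17 + 109) +
        y * (17356 * (y / wallRate y ^ 2) ^ 13 + 23296 * (y / wallRate y ^ 2) ^ 14 + 17048 * (y / wallRate y ^ 2) ^ 15 + 7839 * (y / wallRate y ^ 2) ^ 16 + 1627 * (y / wallRate y ^ 2) ^ 17 + 57 * (y / wallRate y ^ 2) ^ 18 + 332) +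
        (#((ipwb m₁).filter fun ω => visits m₁ ω = 1) * (y / wallRate y ^ 2) ^ 14 + #((ipwb m₂).filter fun ω => visits m₂ ω = 2) * (y / wallRate y ^ 2) ^ 15 +
          #((ipwb m₃).filter fun ω => visits m₃ ω = 3) * (y / wallRate y ^ 2) ^ 16 + #((ipwb m₄).filter fun ω => visits m₄ ω = 4) * (y / wallRate y ^ 2) ^ 17 +
          #((ipwb m₅).filter fun ω => visits m₅ ω = 5) * (y / wallRate y ^ 2) ^ 18 + #((ipwb m₆).filter fun ω => visits m₆ ω = 6) * (y / wallRate y ^ 2) ^ 19 + #((ipwb m₇).filter fun ω => visits m₇ ω = 7) * (y / wallRate y ^ 2) ^ 20) ≤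
      y ^ 13 * (wallRate y ^ 2 - y - 1 / y - 1 / y ^ 2 - 2 / y ^ 3 - 4 / y ^ 4 - 6 / y ^ 5 - 12 / y ^ 6 - 18 / y ^ 7 - 15 / y ^ 8 - 7 / y ^ 9 + 16 / y ^ 10 +
      109 / y ^ 11 + 332 / y ^ 12) ∧
    y ^ 13 * (wallRate y ^ 2 - y - 1 / y - 1 / y ^ 2 - 2 / y ^ 3 - 4 / y ^ 4 - 6 / y ^ 5 - 12 / y ^ 6 - 18 / y ^ 7 - 15 / y ^ 8 - 7 / y ^ 9 + 16 / y ^ 10 +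
      109 / y ^ 11 + 332 / y ^ 12) ≤
      (y ^ 12 * ((y / wallRate y ^ 2) ^ 2 - 1) + y ^ 11 * ((y / wallRate y ^ 2) ^ 3 - 1) +
        y ^ 10 * (3 * (y / wallRate y ^ 2) ^ 4 + (y / wallRate y ^ 2) ^ 5 - 2) +
        y ^ 9 * (6 * (y / wallRate y ^ 2) ^ 5 + 3 * (y / wallRate y ^ 2) ^ 6 - 4) +
        y ^ 8 * (15 * (y / wallRate y ^ 2) ^ 6 + 11 * (y / wallRate y ^ 2) ^ 7 + (y / wallRate y ^ 2) ^ 8 - 6) +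
        y ^ 7 * (38 * (y / wallRate y ^ 2) ^ 7 + 34 * (y / wallRate y ^ 2) ^ 8 + 7 * (y / wallRate y ^ 2) ^ 9 - 12) +
        y ^ 6 * (98 * (y / wallRate y ^ 2) ^ 8 + 99 * (y / wallRate y ^ 2) ^ 9 + 33 * (y / wallRate y ^ 2) ^ 10 + (y / wallRate y ^ 2) ^ 11 - 18) +
        y ^ 5 * (267 * (y / wallRate y ^ 2) ^ 9 + 295 * (y / wallRate y ^ 2) ^ 10 + 132 * (y / wallRate y ^ 2) ^ 11 + 16 * (y / wallRate y ^ 2) ^ 12 - 15) +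
        y ^ 4 * (738 * (y / wallRate y ^ 2) ^ 10 + 860 * (y / wallRate y ^ 2) ^ 11 + 468 * (y / wallRate y ^ 2) ^ 12 + 95 * (y / wallRate y ^ 2) ^ 13 + (y / wallRate y ^ 2) ^ 14 - 7) +
        y ^ 3 * (2085 * (y / wallRate y ^ 2) ^ 11 + 2579 * (y / wallRate y ^ 2) ^ 12 + 1585 * (y / wallRate y ^ 2) ^ 13 + 486 * (y / wallRate y ^ 2) ^ 14 + 32 * (y / wallRate y ^ 2) ^ 15 + 16) +
        y ^ 2 * (5975 * (y / wallRate y ^ 2) ^ 12 + 7718 * (y / wallRate y ^ 2) ^ 13 + 5219 * (y / wallRate y ^ 2) ^ 14 + 2018 * (y / wallRate y ^ 2) ^ 15 + 260 * (y / wallRate y ^ 2) ^ 16 + (y / wallRate y ^ 2) ^ 17 + 109) +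
        y * (17356 * (y / wallRate y ^ 2) ^ 13 + 23296 * (y / wallRate y ^ 2) ^ 14 + 17048 * (y / wallRate y ^ 2) ^ 15 + 7839 * (y / wallRate y ^ 2) ^ 16 + 1627 * (y / wallRate y ^ 2) ^ 17 + 57 * (y / wallRate y ^ 2) ^ 18 + 332) +
        (#((ipwb m₁).filter fun ω => visits m₁ ω = 1) * (y / wallRate y ^ 2) ^ 14 + #((ipwb m₂).filter fun ω => visits m₂ ω = 2) * (y / wallRate y ^ 2) ^ 15 +
          #((ipwb m₃).filter fun ω => visits m₃ ω = 3) * (y / wallRate y ^ 2) ^ 16 + #((ipwb m₄).filter fun ω => visits m₄ ω = 4) * (y / wallRate y ^ 2) ^ 17 +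
          #((ipwb m₅).filter fun ω => visits m₅ ω = 5) * (y / wallRate y ^ 2) ^ 18 + #((ipwb m₆).filter fun ω => visits m₆ ω = 6) * (y / wallRate y ^ 2) ^ 19 + #((ipwb m₇).filter fun ω => visits m₇ ω = 7) * (y / wallRate y ^ 2) ^ 20)) +
      y ^ 13 * wallRate y ^ 2 *
        ((hexConnectiveConstant ^ 2 + y ^ ((2 : ℝ) / 3) / hexConnectiveConstant ^ 2) *
          (hexConnectiveConstant ^ 2 / y ^ ((2 : ℝ) / 3)) / (1 - hexConnectiveConstant ^ 2 / y ^ ((2 : ℝ) / 3)) *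
          (hexConnectiveConstant ^ 2 / y ^ ((2 : ℝ) / 3)) ^ 22 +
          (3 ^ 32 * y / wallRate y ^ 32 + 3 ^ 34 * (y + y ^ 2) / wallRate y ^ 34 + 3 ^ 36 * (y + y ^ 2 + y ^ 3) / wallRate y ^ 36 +
          3 ^ 38 * (y + y ^ 2 + y ^ 3 + y ^ 4) / wallRate y ^ 38 + 3 ^ 40 * (y + y ^ 2 + y ^ 3 + y ^ 4 + y ^ 5) / wallRate y ^ 40 +
          3 ^ 42 * (y + y ^ 2 + y ^ 3 + y ^ 4 + y ^ 5 + y ^ 6) / wallRate y ^ 42 +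
          3 ^ 44 * (y + y ^ 2 + y ^ 3 + y ^ 4 + y ^ 5 + y ^ 6 + y ^ 7) / wallRate y ^ 44)) := by
  have hμ := hexConnectiveConstant_pos
  have hy0 : 0 < y := lt_of_le_of_lt (by positivity) hy
  have hβ := wallRate_pos y
  have hB : wallRate y ≠ 0 := hβ.ne'
  obtain ⟨hlow, hone⟩ := kesten_head_fourteen_sandwich_of_cube_lt h₁ h₂ h₃ h₄ h₅ h₆ h₇ hy
  set N₁ := (#((ipwb m₁).filter fun ω => visits m₁ ω = 1) : ℝ) with hN₁
  set N₂ := (#((ipwb m₂).filter fun ω => visits m₂ ω = 2) : ℝ) with hN₂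
  set N₃ := (#((ipwb m₃).filter fun ω => visits m₃ ω = 3) : ℝ) with hN₃
  set N₄ := (#((ipwb m₄).filter fun ω => visits m₄ ω = 4) : ℝ) with hN₄
  set N₅ := (#((ipwb m₅).filter fun ω => visits m₅ ω = 5) : ℝ) with hN₅
  set N₆ := (#((ipwb m₆).filter fun ω => visits m₆ ω = 6) : ℝ) with hN₆
  set N₇ := (#((ipwb m₇).filter fun ω => visits m₇ ω = 7) : ℝ) with hN₇
  set a := (hexConnectiveConstant ^ 2 + y ^ ((2 : ℝ) / 3) / hexConnectiveConstant ^ 2) *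
          (hexConnectiveConstant ^ 2 / y ^ ((2 : ℝ) / 3)) / (1 - hexConnectiveConstant ^ 2 / y ^ ((2 : ℝ) / 3)) *
          (hexConnectiveConstant ^ 2 / y ^ ((2 : ℝ) / 3)) ^ 22 with ha
  set b := 3 ^ 32 * y / wallRate y ^ 32 + 3 ^ 34 * (y + y ^ 2) / wallRate y ^ 34 + 3 ^ 36 * (y + y ^ 2 + y ^ 3) / wallRate y ^ 36 +
          3 ^ 38 * (y + y ^ 2 + y ^ 3 + y ^ 4) / wallRate y ^ 38 + 3 ^ 40 * (y + y ^ 2 + y ^ 3 + y ^ 4 + y ^ 5) / wallRate y ^ 40 +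
          3 ^ 42 * (y + y ^ 2 + y ^ 3 + y ^ 4 + y ^ 5 + y ^ 6) / wallRate y ^ 42 +
          3 ^ 44 * (y + y ^ 2 + y ^ 3 + y ^ 4 + y ^ 5 + y ^ 6 + y ^ 7) / wallRate y ^ 44 with hb
  set K := y / wallRate y ^ 2 + y / wallRate y ^ 6 + y / wallRate y ^ 8 + 3 * y / wallRate y ^ 10 +
        (6 * y + y ^ 2) / wallRate y ^ 12 + (15 * y + 3 * y ^ 2) / wallRate y ^ 14 + (38 * y + 11 * y ^ 2) / wallRate y ^ 16 +
        (98 * y + 34 * y ^ 2 + y ^ 3) / wallRate y ^ 18 + (267 * y + 99 * y ^ 2 + 7 * y ^ 3) / wallRate y ^ 20 +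
        (738 * y + 295 * y ^ 2 + 33 * y ^ 3) / wallRate y ^ 22 + (2085 * y + 860 * y ^ 2 + 132 * y ^ 3 + y ^ 4) / wallRate y ^ 24 +
        (5975 * y + 2579 * y ^ 2 + 468 * y ^ 3 + 16 * y ^ 4) / wallRate y ^ 26 +
        (17356 * y + 7718 * y ^ 2 + 1585 * y ^ 3 + 95 * y ^ 4) / wallRate y ^ 28 +
        (N₁ * y + 23296 * y ^ 2 + 5219 * y ^ 3 + 486 * y ^ 4 + y ^ 5) / wallRate y ^ 30 +
        (N₂ * y ^ 2 + 17048 * y ^ 3 + 2018 * y ^ 4 + 32 * y ^ 5) / wallRate y ^ 32 +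
        (N₃ * y ^ 3 + 7839 * y ^ 4 + 260 * y ^ 5) / wallRate y ^ 34 +
        (N₄ * y ^ 4 + 1627 * y ^ 5 + y ^ 6) / wallRate y ^ 36 +
        (N₅ * y ^ 5 + 57 * y ^ 6) / wallRate y ^ 38 + N₆ * y ^ 6 / wallRate y ^ 40 + N₇ * y ^ 7 / wallRate y ^ 42 with hK
  have key : y ^ 13 * (wallRate y ^ 2 - y - 1 / y - 1 / y ^ 2 - 2 / y ^ 3 - 4 / y ^ 4 - 6 / y ^ 5 - 12 / y ^ 6 - 18 / y ^ 7 - 15 / y ^ 8 - 7 / y ^ 9 + 16 / y ^ 10 +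
      109 / y ^ 11 + 332 / y ^ 12) -
      (y ^ 12 * ((y / wallRate y ^ 2) ^ 2 - 1) + y ^ 11 * ((y / wallRate y ^ 2) ^ 3 - 1) +
        y ^ 10 * (3 * (y / wallRate y ^ 2) ^ 4 + (y / wallRate y ^ 2) ^ 5 - 2) +
        y ^ 9 * (6 * (y / wallRate y ^ 2) ^ 5 + 3 * (y / wallRate y ^ 2) ^ 6 - 4) +
        y ^ 8 * (15 * (y / wallRate y ^ 2) ^ 6 + 11 * (y / wallRate y ^ 2) ^ 7 + (y / wallRate y ^ 2) ^ 8 - 6) +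
        y ^ 7 * (38 * (y / wallRate y ^ 2) ^ 7 + 34 * (y / wallRate y ^ 2) ^ 8 + 7 * (y / wallRate y ^ 2) ^ 9 - 12) +
        y ^ 6 * (98 * (y / wallRate y ^ 2) ^ 8 + 99 * (y / wallRate y ^ 2) ^ 9 + 33 * (y / wallRate y ^ 2) ^ 10 + (y / wallRate y ^ 2) ^ 11 - 18) +
        y ^ 5 * (267 * (y / wallRate y ^ 2) ^ 9 + 295 * (y / wallRate y ^ 2) ^ 10 + 132 * (y / wallRate y ^ 2) ^ 11 + 16 * (y / wallRate y ^ 2) ^ 12 - 15) +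
        y ^ 4 * (738 * (y / wallRate y ^ 2) ^ 10 + 860 * (y / wallRate y ^ 2) ^ 11 + 468 * (y / wallRate y ^ 2) ^ 12 + 95 * (y / wallRate y ^ 2) ^ 13 + (y / wallRate y ^ 2) ^ 14 - 7) +
        y ^ 3 * (2085 * (y / wallRate y ^ 2) ^ 11 + 2579 * (y / wallRate y ^ 2) ^ 12 + 1585 * (y / wallRate y ^ 2) ^ 13 + 486 * (y / wallRate y ^ 2) ^ 14 + 32 * (y / wallRate y ^ 2) ^ 15 + 16) +
        y ^ 2 * (5975 * (y / wallRate y ^ 2) ^ 12 + 7718 * (y / wallRate y ^ 2) ^ 13 + 5219 * (y / wallRate y ^ 2) ^ 14 + 2018 * (y / wallRate y ^ 2) ^ 15 + 260 * (y / wallRate y ^ 2) ^ 16 + (y / wallRate y ^ 2) ^ 17 + 109) +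
        y * (17356 * (y / wallRate y ^ 2) ^ 13 + 23296 * (y / wallRate y ^ 2) ^ 14 + 17048 * (y / wallRate y ^ 2) ^ 15 + 7839 * (y / wallRate y ^ 2) ^ 16 + 1627 * (y / wallRate y ^ 2) ^ 17 + 57 * (y / wallRate y ^ 2) ^ 18 + 332) +
        (N₁ * (y / wallRate y ^ 2) ^ 14 + N₂ * (y / wallRate y ^ 2) ^ 15 +
          N₃ * (y / wallRate y ^ 2) ^ 16 + N₄ * (y / wallRate y ^ 2) ^ 17 +
          N₅ * (y / wallRate y ^ 2) ^ 18 + N₆ * (y / wallRate y ^ 2) ^ 19 + N₇ * (y / wallRate y ^ 2) ^ 20)) =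
      y ^ 13 * wallRate y ^ 2 * (1 - K) := by
    rw [hK]
    field_simp
    ring
  have hpos : 0 ≤ y ^ 13 * wallRate y ^ 2 := by positivity
  have h0 : 0 ≤ y ^ 13 * wallRate y ^ 2 * (1 - K) := mul_nonneg hpos (sub_nonneg.2 hone)
  have h1 : 1 - K ≤ a + b := by linarith
  have h2 : y ^ 13 * wallRate y ^ 2 * (1 - K) ≤ y ^ 13 * wallRate y ^ 2 * (a + b) := mul_le_mul_of_nonneg_left h1 hpos
  constructor
  · linarith
  · linarith

/-! ### §5  The limit of the comparison function: `G(y, r) → ΣN − 215023` -/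

set_option maxRecDepth 4096 in
set_option maxHeartbeats 800000 in
open Classical in
/-- ★★ **The comparison function tends to the diagonal-fourteen census minus 215023** (120-monomial tower identity in `A, Q, P, H, K, L, M, R₉, R₁₀, R₁₁, R₁₂`, `u`;
budget line `maxHeartbeats 800000` for the `ring` identity).
[cite: BeatonBousquetMelouDeGierDuminilCopinGuttmann2014, Section 3.1, Proposition 5 (arXiv v5 p. 9)] [cite: MadrasSlade1993, Section 4.2, (4.2.4) (p. 91)] -/
theorem tendsto_fourteenth_order_comparison (m₁ m₂ m₃ m₄ m₅ m₆ m₇ : ℕ) :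
    Tendsto (fun y : ℝ => y ^ 12 * ((y / wallRate y ^ 2) ^ 2 - 1) + y ^ 11 * ((y / wallRate y ^ 2) ^ 3 - 1) +
        y ^ 10 * (3 * (y / wallRate y ^ 2) ^ 4 + (y / wallRate y ^ 2) ^ 5 - 2) +
        y ^ 9 * (6 * (y / wallRate y ^ 2) ^ 5 + 3 * (y / wallRate y ^ 2) ^ 6 - 4) +
        y ^ 8 * (15 * (y / wallRate y ^ 2) ^ 6 + 11 * (y / wallRate y ^ 2) ^ 7 + (y / wallRate y ^ 2) ^ 8 - 6) +
        y ^ 7 * (38 * (y / wallRate y ^ 2) ^ 7 + 34 * (y / wallRate y ^ 2) ^ 8 + 7 * (y / wallRate y ^ 2) ^ 9 - 12) +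
        y ^ 6 * (98 * (y / wallRate y ^ 2) ^ 8 + 99 * (y / wallRate y ^ 2) ^ 9 + 33 * (y / wallRate y ^ 2) ^ 10 + (y / wallRate y ^ 2) ^ 11 - 18) +
        y ^ 5 * (267 * (y / wallRate y ^ 2) ^ 9 + 295 * (y / wallRate y ^ 2) ^ 10 + 132 * (y / wallRate y ^ 2) ^ 11 + 16 * (y / wallRate y ^ 2) ^ 12 - 15) +
        y ^ 4 * (738 * (y / wallRate y ^ 2) ^ 10 + 860 * (y / wallRate y ^ 2) ^ 11 + 468 * (y / wallRate y ^ 2) ^ 12 + 95 * (y / wallRate y ^ 2) ^ 13 + (y / wallRate y ^ 2) ^ 14 - 7) +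
        y ^ 3 * (2085 * (y / wallRate y ^ 2) ^ 11 + 2579 * (y / wallRate y ^ 2) ^ 12 + 1585 * (y / wallRate y ^ 2) ^ 13 + 486 * (y / wallRate y ^ 2) ^ 14 + 32 * (y / wallRate y ^ 2) ^ 15 + 16) +
        y ^ 2 * (5975 * (y / wallRate y ^ 2) ^ 12 + 7718 * (y / wallRate y ^ 2) ^ 13 + 5219 * (y / wallRate y ^ 2) ^ 14 + 2018 * (y / wallRate y ^ 2) ^ 15 + 260 * (y / wallRate y ^ 2) ^ 16 + (y / wallRate y ^ 2) ^ 17 + 109) +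
        y * (17356 * (y / wallRate y ^ 2) ^ 13 + 23296 * (y / wallRate y ^ 2) ^ 14 + 17048 * (y / wallRate y ^ 2) ^ 15 + 7839 * (y / wallRate y ^ 2) ^ 16 + 1627 * (y / wallRate y ^ 2) ^ 17 + 57 * (y / wallRate y ^ 2) ^ 18 + 332) +
        (#((ipwb m₁).filter fun ω => visits m₁ ω = 1) * (y / wallRate y ^ 2) ^ 14 + #((ipwb m₂).filter fun ω => visits m₂ ω = 2) * (y / wallRate y ^ 2) ^ 15 +
          #((ipwb m₃).filter fun ω => visits m₃ ω = 3) * (y / wallRate y ^ 2) ^ 16 + #((ipwb m₄).filter fun ω => visits m₄ ω = 4) * (y / wallRate y ^ 2) ^ 17 +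
          #((ipwb m₅).filter fun ω => visits m₅ ω = 5) * (y / wallRate y ^ 2) ^ 18 + #((ipwb m₆).filter fun ω => visits m₆ ω = 6) * (y / wallRate y ^ 2) ^ 19 + #((ipwb m₇).filter fun ω => visits m₇ ω = 7) * (y / wallRate y ^ 2) ^ 20))
      atTop (𝓝 ((#((ipwb m₁).filter fun ω => visits m₁ ω = 1) : ℝ) + #((ipwb m₂).filter fun ω => visits m₂ ω = 2) +
        #((ipwb m₃).filter fun ω => visits m₃ ω = 3) + #((ipwb m₄).filter fun ω => visits m₄ ω = 4) + #((ipwb m₅).filter fun ω => visits m₅ ω = 5) + #((ipwb m₆).filter fun ω => visits m₆ ω = 6) + #((ipwb m₇).filter fun ω => visits m₇ ω = 7) - 215023)) := by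
  set N₁ := (#((ipwb m₁).filter fun ω => visits m₁ ω = 1) : ℝ) with hN₁
  set N₂ := (#((ipwb m₂).filter fun ω => visits m₂ ω = 2) : ℝ) with hN₂
  set N₃ := (#((ipwb m₃).filter fun ω => visits m₃ ω = 3) : ℝ) with hN₃
  set N₄ := (#((ipwb m₄).filter fun ω => visits m₄ ω = 4) : ℝ) with hN₄
  set N₅ := (#((ipwb m₅).filter fun ω => visits m₅ ω = 5) : ℝ) with hN₅
  set N₆ := (#((ipwb m₆).filter fun ω => visits m₆ ω = 6) : ℝ) with hN₆
  set N₇ := (#((ipwb m₇).filter fun ω => visits m₇ ω = 7) : ℝ) with hN₇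
  have hr := tendsto_div_sq_wallRate_fo
  have hA := tendsto_sq_mul_one_sub_div_wallRate_sq
  have hQ := tendsto_cube_mul_one_sub_div_sub
  have hP := tendsto_pow_four_mul_one_sub_div_sub
  have hH := tendsto_pow_five_mul_one_sub_div_sub
  have hK := tendsto_pow_six_mul_one_sub_div_sub
  have hL := tendsto_pow_seven_mul_one_sub_div_sub
  have hM := tendsto_pow_eight_mul_one_sub_div_sub
  have hR := tendsto_pow_nine_mul_one_sub_div_sub
  have hW := tendsto_pow_ten_mul_one_sub_div_sub
  have hX := tendsto_pow_eleven_mul_one_sub_div_sub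
  have hZ := tendsto_pow_twelve_mul_one_sub_div_sub
  have hu : Tendsto (fun y : ℝ => y⁻¹) atTop (𝓝 0) := tendsto_inv_atTop_zero
  have hN := (((((((hr.pow 14).const_mul N₁).add ((hr.pow 15).const_mul N₂)).add ((hr.pow 16).const_mul N₃)).add ((hr.pow 17).const_mul N₄)).add
    ((hr.pow 18).const_mul N₅)).add ((hr.pow 19).const_mul N₆)).add ((hr.pow 20).const_mul N₇)
  have h0 := ((((((((((((((((((((((((((((((((((((((((((((((((((((((((((((((((((((((((((((((((((((((((((((((((((((((((((((((((((((((((hZ.const_mul ((-2) : ℝ)).add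
      (hX.const_mul ((-3) : ℝ))).add
      (hW.const_mul ((-15) : ℝ))).add
      (hR.const_mul ((-40) : ℝ))).add
      (hM.const_mul ((-111) : ℝ))).add
      (hL.const_mul ((-328) : ℝ))).add
      (hK.const_mul ((-848) : ℝ))).add
      (hH.const_mul ((-2418) : ℝ))).add
      (hP.const_mul ((-8580) : ℝ))).add
      (hQ.const_mul ((-54316) : ℝ))).add
      (hA.const_mul ((-279547) : ℝ))).add
      ((hA.mul hu).const_mul ((-961601) : ℝ))).add
      ((hK.pow 2).const_mul (1 : ℝ))).add
      ((hH.mul hK).const_mul (3 : ℝ))).add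
      ((hH.pow 2).const_mul (28 : ℝ))).add
      ((hP.mul hH).const_mul (102 : ℝ))).add
      ((hP.pow 2).const_mul (416 : ℝ))).add
      ((hQ.mul hP).const_mul (1620 : ℝ))).add
      ((hQ.pow 2).const_mul (6390 : ℝ))).add
      ((hA.mul hQ).const_mul (27456 : ℝ))).add
      ((hA.pow 2).const_mul (118899 : ℝ))).add
      (((hA.pow 2).mul hu).const_mul (456105 : ℝ))).add
      (((hA.pow 2).mul (hu.pow 2)).const_mul (1714509 : ℝ))).add
      (((hA.pow 2).mul (hu.pow 3)).const_mul (6434417 : ℝ))).add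
      ((hQ.mul (hP.pow 2)).const_mul ((-1) : ℝ))).add
      (((hQ.pow 2).mul hP).const_mul ((-22) : ℝ))).add
      ((hQ.pow 3).const_mul ((-120) : ℝ))).add
      ((hA.mul (hQ.pow 2)).const_mul ((-725) : ℝ))).add
      (((hA.pow 2).mul hQ).const_mul ((-3747) : ℝ))).add
      ((hA.pow 3).const_mul ((-17929) : ℝ))).add
      (((hA.pow 3).mul hu).const_mul ((-83128) : ℝ))).add
      (((hA.pow 3).mul (hu.pow 2)).const_mul ((-360954) : ℝ))).add
      (((hA.pow 3).mul (hu.pow 3)).const_mul ((-1556179) : ℝ))).add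
      (((hA.pow 3).mul (hu.pow 4)).const_mul ((-6486034) : ℝ))).add
      (((hA.pow 3).mul (hu.pow 5)).const_mul ((-26743112) : ℝ))).add
      (((hA.pow 2).mul (hQ.pow 2)).const_mul (8 : ℝ))).add
      (((hA.pow 3).mul hQ).const_mul (75 : ℝ))).add
      ((hA.pow 4).const_mul (680 : ℝ))).add
      (((hA.pow 4).mul hu).const_mul (4592 : ℝ))).add
      (((hA.pow 4).mul (hu.pow 2)).const_mul (26594 : ℝ))).add
      (((hA.pow 4).mul (hu.pow 3)).const_mul (147072 : ℝ))).add
      (((hA.pow 4).mul (hu.pow 4)).const_mul (739366 : ℝ))).add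
      (((hA.pow 4).mul (hu.pow 5)).const_mul (3628096 : ℝ))).add
      (((hA.pow 4).mul (hu.pow 6)).const_mul (16930364 : ℝ))).add
      (((hA.pow 4).mul (hu.pow 7)).const_mul (77313016 : ℝ))).add
      ((hA.pow 5).const_mul ((-1) : ℝ))).add
      (((hA.pow 5).mul hu).const_mul ((-24) : ℝ))).add
      (((hA.pow 5).mul (hu.pow 2)).const_mul ((-377) : ℝ))).add
      (((hA.pow 5).mul (hu.pow 3)).const_mul ((-3584) : ℝ))).add
      (((hA.pow 5).mul (hu.pow 4)).const_mul ((-26740) : ℝ))).add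
      (((hA.pow 5).mul (hu.pow 5)).const_mul ((-181638) : ℝ))).add
      (((hA.pow 5).mul (hu.pow 6)).const_mul ((-1078219) : ℝ))).add
      (((hA.pow 5).mul (hu.pow 7)).const_mul ((-6114801) : ℝ))).add
      (((hA.pow 5).mul (hu.pow 8)).const_mul ((-32315626) : ℝ))).add
      (((hA.pow 5).mul (hu.pow 9)).const_mul ((-164967912) : ℝ))).add
      (((hA.pow 6).mul (hu.pow 3)).const_mul (3 : ℝ))).add
      (((hA.pow 6).mul (hu.pow 4)).const_mul (120 : ℝ))).add
      (((hA.pow 6).mul (hu.pow 5)).const_mul (1806 : ℝ))).add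
      (((hA.pow 6).mul (hu.pow 6)).const_mul (18452 : ℝ))).add
      (((hA.pow 6).mul (hu.pow 7)).const_mul (160146 : ℝ))).add
      (((hA.pow 6).mul (hu.pow 8)).const_mul (1150755 : ℝ))).add
      (((hA.pow 6).mul (hu.pow 9)).const_mul (7685744 : ℝ))).add
      (((hA.pow 6).mul (hu.pow 10)).const_mul (46632191 : ℝ))).add
      (((hA.pow 6).mul (hu.pow 11)).const_mul (269034636 : ℝ))).add
      (((hA.pow 7).mul (hu.pow 6)).const_mul ((-19) : ℝ))).add
      (((hA.pow 7).mul (hu.pow 7)).const_mul ((-562) : ℝ))).add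
      (((hA.pow 7).mul (hu.pow 8)).const_mul ((-8638) : ℝ))).add
      (((hA.pow 7).mul (hu.pow 9)).const_mul ((-101244) : ℝ))).add
      (((hA.pow 7).mul (hu.pow 10)).const_mul ((-909468) : ℝ))).add
      (((hA.pow 7).mul (hu.pow 11)).const_mul ((-7324350) : ℝ))).add
      (((hA.pow 7).mul (hu.pow 12)).const_mul ((-51867574) : ℝ))).add
      (((hA.pow 7).mul (hu.pow 13)).const_mul ((-342572672) : ℝ))).add
      ((hA.pow 8).mul (hu.pow 8))).add
      (((hA.pow 8).mul (hu.pow 9)).const_mul (97 : ℝ))).add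
      (((hA.pow 8).mul (hu.pow 10)).const_mul (2639 : ℝ))).add
      (((hA.pow 8).mul (hu.pow 11)).const_mul (45378 : ℝ))).add
      (((hA.pow 8).mul (hu.pow 12)).const_mul (532038 : ℝ))).add
      (((hA.pow 8).mul (hu.pow 13)).const_mul (5325903 : ℝ))).add
      (((hA.pow 8).mul (hu.pow 14)).const_mul (44919688 : ℝ))).add
      (((hA.pow 8).mul (hu.pow 15)).const_mul (344933446 : ℝ))).add
      (((hA.pow 9).mul (hu.pow 11)).const_mul ((-7) : ℝ))).add
      (((hA.pow 9).mul (hu.pow 12)).const_mul ((-484) : ℝ))).add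
      (((hA.pow 9).mul (hu.pow 13)).const_mul ((-13997) : ℝ))).add
      (((hA.pow 9).mul (hu.pow 14)).const_mul ((-227567) : ℝ))).add
      (((hA.pow 9).mul (hu.pow 15)).const_mul ((-2948462) : ℝ))).add
      (((hA.pow 9).mul (hu.pow 16)).const_mul ((-30380108) : ℝ))).add
      (((hA.pow 9).mul (hu.pow 17)).const_mul ((-276375242) : ℝ))).add
      (((hA.pow 10).mul (hu.pow 14)).const_mul (44 : ℝ))).add
      (((hA.pow 10).mul (hu.pow 15)).const_mul (2803 : ℝ))).add
      (((hA.pow 10).mul (hu.pow 16)).const_mul (69257 : ℝ))).add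
      (((hA.pow 10).mul (hu.pow 17)).const_mul (1229041 : ℝ))).add
      (((hA.pow 10).mul (hu.pow 18)).const_mul (15987499 : ℝ))).add
      (((hA.pow 10).mul (hu.pow 19)).const_mul (176389070 : ℝ))).add
      (((hA.pow 11).mul (hu.pow 16)).const_mul ((-1) : ℝ))).add
      (((hA.pow 11).mul (hu.pow 17)).const_mul ((-324) : ℝ))).add
      (((hA.pow 11).mul (hu.pow 18)).const_mul ((-14250) : ℝ))).add
      (((hA.pow 11).mul (hu.pow 19)).const_mul ((-377247) : ℝ))).add
      (((hA.pow 11).mul (hu.pow 20)).const_mul ((-6476046) : ℝ))).add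
      (((hA.pow 11).mul (hu.pow 21)).const_mul ((-89294504) : ℝ))).add
      (((hA.pow 12).mul (hu.pow 19)).const_mul (16 : ℝ))).add
      (((hA.pow 12).mul (hu.pow 20)).const_mul (1794 : ℝ))).add
      (((hA.pow 12).mul (hu.pow 21)).const_mul (81970 : ℝ))).add
      (((hA.pow 12).mul (hu.pow 22)).const_mul (1978816 : ℝ))).add
      (((hA.pow 12).mul (hu.pow 23)).const_mul (35495408 : ℝ))).add
      (((hA.pow 13).mul (hu.pow 22)).const_mul ((-109) : ℝ))).add
      (((hA.pow 13).mul (hu.pow 23)).const_mul ((-11749) : ℝ))).add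
      (((hA.pow 13).mul (hu.pow 24)).const_mul ((-440654) : ℝ))).add
      (((hA.pow 13).mul (hu.pow 25)).const_mul ((-10884016) : ℝ))).add
      ((hA.pow 14).mul (hu.pow 24))).add
      (((hA.pow 14).mul (hu.pow 25)).const_mul (966 : ℝ))).add
      (((hA.pow 14).mul (hu.pow 26)).const_mul (67369 : ℝ))).add
      (((hA.pow 14).mul (hu.pow 27)).const_mul (2500476 : ℝ))).add
      (((hA.pow 15).mul (hu.pow 27)).const_mul ((-32) : ℝ))).add
      (((hA.pow 15).mul (hu.pow 28)).const_mul ((-6314) : ℝ))).add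
      (((hA.pow 15).mul (hu.pow 29)).const_mul ((-410256) : ℝ))).add
      (((hA.pow 16).mul (hu.pow 30)).const_mul (277 : ℝ))).add
      (((hA.pow 16).mul (hu.pow 31)).const_mul (44219 : ℝ))).add
      (((hA.pow 17).mul (hu.pow 32)).const_mul ((-1) : ℝ))).add
      (((hA.pow 17).mul (hu.pow 33)).const_mul ((-2653) : ℝ))).add
      (((hA.pow 18).mul (hu.pow 35)).const_mul (57 : ℝ)))
  have h := h0.add hN
  refine Tendsto.congr' ?_ (tendsto_of_tendsto_of_eq_fo h (by ring))
  filter_upwards [eventually_gt_atTop (0 : ℝ)] with y hy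
  have hw : wallRate y ≠ 0 := (wallRate_pos y).ne'
  have hy' : y ≠ 0 := hy.ne'
  field_simp
  ring

/-! ### §6  THE FOURTEENTH COEFFICIENT IS THE DIAGONAL-FOURTEEN CENSUS MINUS 215023 -/

set_option maxRecDepth 4096 in
open Classical in
/-- ★★★ **THE FOURTEENTH-ORDER CENSUS IDENTITY.**  As `y → ∞`,
`y¹³ (β(y)² − y − 1/y − 1/y² − 2/y³ − 4/y⁴ − 6/y⁵ − 12/y⁶ − 18/y⁷ − 15/y⁸ − 7/y⁹ + 16/y¹⁰ + 109/y¹¹ + 332/y¹²) → N₁₅,₁ + N₁₆,₂ + N₁₇,₃ + N₁₈,₄ + N₁₉,₅ + N₂₀,₆ + N₂₁,₇ − 215023`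
(symbolic lengths `m₁ = 30, …, m₇ = 42`).  With the data `51018 / 70726 / 55092 / 28622 / 8045 / 649 / 1` it is `a₁₃ = −870`.
[cite: Kesten1963SAW, Section 4] [cite: MadrasSlade1993, Section 4.2, (4.2.4), Theorem 4.2.2 (pp. 91–92)] [cite: BeatonBousquetMelouDeGierDuminilCopinGuttmann2014, Section 3.1, Proposition 5 (arXiv v5 p. 9); p. 10] -/
theorem tendsto_pow_thirteen_mul_wallRate_sq_sub_census {m₁ m₂ m₃ m₄ m₅ m₆ m₇ : ℕ} (h₁ : m₁ = 30) (h₂ : m₂ = 32) (h₃ : m₃ = 34) (h₄ : m₄ = 36) (h₅ : m₅ = 38) (h₆ : m₆ = 40) (h₇ : m₇ = 42) :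
    Tendsto (fun y : ℝ => y ^ 13 * (wallRate y ^ 2 - y - 1 / y - 1 / y ^ 2 - 2 / y ^ 3 - 4 / y ^ 4 - 6 / y ^ 5 - 12 / y ^ 6 - 18 / y ^ 7 - 15 / y ^ 8 - 7 / y ^ 9 + 16 / y ^ 10 +
      109 / y ^ 11 + 332 / y ^ 12)) atTop
      (𝓝 ((#((ipwb m₁).filter fun ω => visits m₁ ω = 1) : ℝ) + #((ipwb m₂).filter fun ω => visits m₂ ω = 2) +
        #((ipwb m₃).filter fun ω => visits m₃ ω = 3) + #((ipwb m₄).filter fun ω => visits m₄ ω = 4) + #((ipwb m₅).filter fun ω => visits m₅ ω = 5) + #((ipwb m₆).filter fun ω => visits m₆ ω = 6) + #((ipwb m₇).filter fun ω => visits m₇ ω = 7) - 215023)) := by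
  have hlo := tendsto_fourteenth_order_comparison m₁ m₂ m₃ m₄ m₅ m₆ m₇
  have hup := hlo.add tendsto_pow_thirteen_mul_sq_wallRate_mul_tail_fourteen
  rw [add_zero] at hup
  refine tendsto_of_tendsto_of_tendsto_of_le_of_le' hlo hup ?_ ?_
  · filter_upwards [eventually_gt_atTop (hexConnectiveConstant ^ 3)] with y hy using (fourteenth_order_two_sided_of_cube_lt h₁ h₂ h₃ h₄ h₅ h₆ h₇ hy).1
  · filter_upwards [eventually_gt_atTop (hexConnectiveConstant ^ 3)] with y hy using (fourteenth_order_two_sided_of_cube_lt h₁ h₂ h₃ h₄ h₅ h₆ h₇ hy).2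

set_option maxRecDepth 4096 in
open Classical in
/-- ★★ Uniqueness form. [cite: MadrasSlade1993, Section 4.2, Theorem 4.2.2 (pp. 91–92)] -/
theorem eq_census_of_tendsto_pow_thirteen_mul_wallRate_sq_sub {m₁ m₂ m₃ m₄ m₅ m₆ m₇ : ℕ} (h₁ : m₁ = 30) (h₂ : m₂ = 32) (h₃ : m₃ = 34) (h₄ : m₄ = 36) (h₅ : m₅ = 38) (h₆ : m₆ = 40) (h₇ : m₇ = 42)
    {L : ℝ} (h : Tendsto (fun y : ℝ => y ^ 13 * (wallRate y ^ 2 - y - 1 / y - 1 / y ^ 2 - 2 / y ^ 3 - 4 / y ^ 4 - 6 / y ^ 5 - 12 / y ^ 6 - 18 / y ^ 7 - 15 / y ^ 8 - 7 / y ^ 9 + 16 / y ^ 10 +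
      109 / y ^ 11 + 332 / y ^ 12)) atTop (𝓝 L)) :
    L = ((#((ipwb m₁).filter fun ω => visits m₁ ω = 1) : ℝ) + #((ipwb m₂).filter fun ω => visits m₂ ω = 2) +
        #((ipwb m₃).filter fun ω => visits m₃ ω = 3) + #((ipwb m₄).filter fun ω => visits m₄ ω = 4) + #((ipwb m₅).filter fun ω => visits m₅ ω = 5) + #((ipwb m₆).filter fun ω => visits m₆ ω = 6) + #((ipwb m₇).filter fun ω => visits m₇ ω = 7) - 215023) :=
  tendsto_nhds_unique h (tendsto_pow_thirteen_mul_wallRate_sq_sub_census h₁ h₂ h₃ h₄ h₅ h₆ h₇)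

end Literature.Probability.RandomPlanarGeometry.SAW.HexBW.Wall

end
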